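import Mathlib.Data.Int.Interval
import Mathlib.Data.Int.GCD
import Mathlib.Data.Real.Basic
import Mathlib.NumberTheory.PrimeCounting
import Mathlib.NumberTheory.Harmonic.Bounds
import Mathlib.NumberTheory.Chebyshev
import Mathlib.Tactic
import HarnessLib

/-!
# Squarefree values of `4A³ + 27B²` away from `2` in congruence classes: an elementary sieve

Topic `Literature/NumberTheory/EllipticCurves`, family `bsd` (**bsd.S26**). This file serves
`BSDRankZeroFamily.lean` — the root-number family of §4.1 of

> M. Bhargava, A. Shankar, *Ternary cubic forms having bounded invariants, and the existence of a
> positive proportion of elliptic curves having rank 0*, Ann. of Math. 181 (2015) 587–621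
> (arXiv:1007.0052v2),

and through it the named fact `Literature.NumberTheory.EllipticCurves.pos_proportion_rank_zero` (`BSDWave0.lean`,
`BSDRankZeroDensity.lean`). Everything here is elementary and **proved** (no named facts).

## Main result

`main_count`: for a modulus `N ≥ 1`, a class `(a₀, b₀) mod N` such that every odd prime `p ∣ N`
has `p² ∣ N` and `p² ∤ 4a₀³ + 27b₀²`, and a sign `s`, there is `c > 0` such that for all large
`X : ℕ` at least `c · X^{1/3} · X^{1/2}` integer pairs `(A, B)` with `A ∈ Ibox s X` (an interval of
length `≍ X^{1/3}` on which `4A³ + 27B²` has the sign `s`) and `|B| ≤ u(X) ≍ X^{1/2}` (so that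
`E_{A,B} : y² = x³ + Ax + B` has naive height `max(4|A|³, 27B²) < X`) lie in the class and have
`4A³ + 27B²` divisible by the square of no odd prime (`OddSqfree`). This is the counting input for
the largeness and the positive density of the §4.1 family (the source obtains its counts from its
Thm 37, an asymptotic with a uniformity estimate; only a lower bound of the right order of
magnitude is needed, for which a union bound suffices).

## Method

* the class count from below, `(#I/N − 1)(#J/N − 1)` (`le_card_filter_class`);
* local counts, uniform in the class modulo `N` for `p ∤ N`: at `p = 3`, `9 ∣ 4A³ + 27B² ⇔ 3 ∣ A`
  (proportion `1/3`, `card_filter_class_nine_dvd_le`); at `p ≥ 5`, for `p ∤ A` the solutions `B` of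
  `27B² ≡ −4A³ (mod p²)` lie in two classes modulo `p²` (`sq_dvd_sub_or_sq_dvd_add`), and for
  `p ∣ A` they satisfy `p ∣ B`, whence a proportion `≤ 3/p²` (`card_filter_class_sq_dvd_le`);
* `∑_{p ≥ 5 prime} 1/p² ≤ ∑_{k ≥ 2} 1/(2k+1)² ≤ 1/8`, so the main term keeps the positive constant
  `1 − 1/3 − 3/8 = 7/24` (`sieve_lower_bound`, the finite form);
* every odd prime `p ≤ P` is sieved, where `P² ≥ |4A³ + 27B²|` on the box (a prime `p > P` with
  `p² ∣ D` forces `D = 0`, which is excluded at `p = 3`); the boundary terms are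
  `O((#I + #J)·H_P + #I·π(P))` with `H_P ≤ 1 + log P` (Mathlib's `harmonic_le_one_add_log`) and
  `π(P) = o(P)` (Mathlib's Chebyshev bound `Chebyshev.pi_le_log4_mul_div`), both `o(X^{5/6})`
  because `P ≍ X^{1/2}` (`main_count`, the asymptotic form).

## Notation

`negDisc (A, B) = 4A³ + 27B²` (`= −Disc(x³ + Ax + B)`; the discriminant of `E_{A,B}` is `−16` times
it); `OddSqfree`; `primesIcc`, `harmonicR`; the scales `aX X = X^{1/3}`, `bX X = √X`,
`tX X = ⌊(X/33)^{1/3}⌋`, `uX X = ⌊√(tX X)³/7⌋`, `PX X = ⌊√(32 t³ + 27 u²)⌋ + 1`; the boxes `Ibox s X`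
(`[1, 2t]` or `[−2t, −t−1]`), `Jbox X = [−u, u]`; the constants `alpha = 33^{-1/3}`,
`beta = √(alpha³/7)`, `mI s ∈ {2, 1}`. All declarations live in the namespace
`Literature.BSD.RankZeroSieve`.

## References

* [BhargavaShankarTernary2015] M. Bhargava, A. Shankar, Ann. of Math. (2) 181 (2015), no. 2,
  587–621, doi:10.4007/annals.2015.181.2.4 = arXiv:1007.0052v2: §4.1 (the family `F`), Thm 37.
* Chebyshev's bound and the harmonic sum: Mathlib, `Mathlib.NumberTheory.Chebyshev`,
  `Mathlib.NumberTheory.Harmonic.Bounds`.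
-/

open Finset

namespace Literature.NumberTheory.EllipticCurves.RankZeroSieve

/-- If all pairwise differences of the elements of `S ⊆ [lo, hi]` are divisible by `m ≥ 1`, then
`#S ≤ #[lo, hi] / m + 1`. [folklore] -/
theorem card_le_of_forall_dvd_sub {S : Finset ℤ} {lo hi : ℤ} {m : ℕ} (hm : 0 < m)
    (hS : ∀ x ∈ S, lo ≤ x ∧ x ≤ hi) (hdvd : ∀ x ∈ S, ∀ y ∈ S, (m : ℤ) ∣ x - y) :
    (S.card : ℝ) ≤ ((Finset.Icc lo hi).card : ℝ) / m + 1 := by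
  rcases S.eq_empty_or_nonempty with rfl | hne
  · simp only [Finset.card_empty, Nat.cast_zero]; positivity
  obtain ⟨x₀, hx₀⟩ := hne
  have hlohi : lo ≤ hi := (hS x₀ hx₀).1.trans (hS x₀ hx₀).2
  have hm0 : (0 : ℤ) < m := by exact_mod_cast hm
  set q : ℕ := ((hi - lo) / m).toNat with hq
  have hqz : (q : ℤ) = (hi - lo) / m := by
    rw [hq, Int.toNat_of_nonneg (Int.ediv_nonneg (by linarith) hm0.le)]
  have hmaps : ∀ x ∈ S, ((x - lo) / m).toNat ∈ Finset.range (q + 1) := by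
    intro x hx
    rw [Finset.mem_range, Nat.lt_succ_iff]
    have h1 : (x - lo) / m ≤ (hi - lo) / m :=
      Int.ediv_le_ediv hm0 (by linarith [(hS x hx).2])
    have h0 : 0 ≤ (x - lo) / m := Int.ediv_nonneg (by linarith [(hS x hx).1]) hm0.le
    have : (((x - lo) / m).toNat : ℤ) ≤ q := by
      rw [Int.toNat_of_nonneg h0, hqz]; exact h1
    exact_mod_cast this
  have hinj : Set.InjOn (fun x : ℤ ↦ ((x - lo) / m).toNat) S := by
    intro x hx y hy hxy
    simp only at hxy
    have h0x : 0 ≤ (x - lo) / m := Int.ediv_nonneg (by linarith [(hS x hx).1]) hm0.le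
    have h0y : 0 ≤ (y - lo) / m := Int.ediv_nonneg (by linarith [(hS y hy).1]) hm0.le
    have heq : (x - lo) / m = (y - lo) / m := by
      have := congrArg (fun n : ℕ ↦ (n : ℤ)) hxy
      simpa only [Int.toNat_of_nonneg h0x, Int.toNat_of_nonneg h0y] using this
    obtain ⟨k, hk⟩ := hdvd x hx y hy
    have hx' := Int.emod_add_mul_ediv (x - lo) m
    have hy' := Int.emod_add_mul_ediv (y - lo) m
    have hrx := Int.emod_nonneg (x - lo) hm0.ne'
    have hry := Int.emod_nonneg (y - lo) hm0.ne'
    have hrx' := Int.emod_lt_of_pos (x - lo) hm0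
    have hry' := Int.emod_lt_of_pos (y - lo) hm0
    have hdiff : x - y = (x - lo) % m - (y - lo) % m := by rw [heq] at hx'; linarith
    have hlt1 : x - y < m := by linarith
    have hlt2 : -(m : ℤ) < x - y := by linarith
    rcases lt_trichotomy k 0 with hk0 | hk0 | hk0
    · have : (m : ℤ) * k ≤ (m : ℤ) * (-1) := Int.mul_le_mul_of_nonneg_left (by omega) hm0.le
      linarith
    · rw [hk0, mul_zero] at hk; linarith
    · have : (m : ℤ) * 1 ≤ (m : ℤ) * k := Int.mul_le_mul_of_nonneg_left (by omega) hm0.le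
      linarith
  have hcard := Finset.card_le_card_of_injOn _ hmaps hinj
  rw [Finset.card_range] at hcard
  have hq' : (q : ℝ) ≤ ((Finset.Icc lo hi).card : ℝ) / m := by
    rw [Int.card_Icc, le_div_iff₀ (by exact_mod_cast hm)]
    have h1 : ((hi - lo) / m : ℤ) * m ≤ hi - lo := Int.ediv_mul_le _ hm0.ne'
    have h2 : ((hi + 1 - lo).toNat : ℤ) = hi + 1 - lo := Int.toNat_of_nonneg (by linarith)
    have : (q : ℤ) * m ≤ ((hi + 1 - lo).toNat : ℤ) := by rw [hqz, h2]; linarith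
    exact_mod_cast this
  calc (S.card : ℝ) ≤ ((q + 1 : ℕ) : ℝ) := by exact_mod_cast hcard
    _ = q + 1 := by push_cast; ring
    _ ≤ _ := by linarith

/-- Elements of `[lo, hi]` in a fixed residue class modulo `m ≥ 1`: at least `#[lo, hi] / m - 1`.
[folklore] -/
theorem le_card_filter_modEq (lo hi r : ℤ) {m : ℕ} (hm : 0 < m) :
    ((Finset.Icc lo hi).card : ℝ) / m - 1 ≤
      ((Finset.Icc lo hi).filter (fun x ↦ x ≡ r [ZMOD m])).card := by
  have hm0 : (0 : ℤ) < m := by exact_mod_cast hm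
  rcases lt_or_ge hi lo with hlt | hle
  · have : Finset.Icc lo hi = ∅ := Finset.Icc_eq_empty (not_le.mpr hlt)
    simp [this]
  set n : ℤ := hi + 1 - lo with hn
  set q : ℤ := n / m with hqdef
  have hq0 : 0 ≤ q := Int.ediv_nonneg (by omega) hm0.le
  set x₀ : ℤ := lo + (r - lo) % m with hx₀
  have hr0 := Int.emod_nonneg (r - lo) hm0.ne'
  have hr1 := Int.emod_lt_of_pos (r - lo) hm0
  have hqm : q * m ≤ n := Int.ediv_mul_le _ hm0.ne'
  have hmaps : ∀ i ∈ Finset.range q.toNat,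
      x₀ + (i : ℤ) * m ∈ (Finset.Icc lo hi).filter (fun x ↦ x ≡ r [ZMOD m]) := by
    intro i hi'
    rw [Finset.mem_range] at hi'
    have hi2 : (i : ℤ) + 1 ≤ q := by
      have := Int.toNat_of_nonneg hq0; omega
    rw [Finset.mem_filter, Finset.mem_Icc]
    refine ⟨⟨by rw [hx₀]; nlinarith, ?_⟩, ?_⟩
    · have : (i : ℤ) * m ≤ (q - 1) * m := mul_le_mul_of_nonneg_right (by linarith) hm0.le
      rw [hx₀]; nlinarith
    · -- x₀ + i m ≡ r
      have h1 : x₀ ≡ r [ZMOD m] := by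
        rw [hx₀, Int.ModEq]
        have := Int.emod_add_mul_ediv (r - lo) m
        have : lo + (r - lo) % m = r - m * ((r - lo) / m) := by linarith
        rw [this, Int.sub_mul_emod_self_left]  -- (r - m * k) % m = r % m ? name check
      have h2 : (i : ℤ) * m ≡ 0 [ZMOD m] := by
        rw [Int.modEq_zero_iff_dvd]; exact Dvd.intro_left _ rfl
      simpa using h1.add h2
  have hinj : Set.InjOn (fun i : ℕ ↦ x₀ + (i : ℤ) * m) (Finset.range q.toNat) := by
    intro i _ j _ h
    simp only at h
    have : (i : ℤ) * m = (j : ℤ) * m := by linarith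
    exact_mod_cast mul_right_cancel₀ hm0.ne' this
  have hcard := Finset.card_le_card_of_injOn _ hmaps hinj
  rw [Finset.card_range] at hcard
  have h1 : ((Finset.Icc lo hi).card : ℝ) = n := by
    rw [Int.card_Icc, hn]
    have : ((hi + 1 - lo).toNat : ℤ) = hi + 1 - lo := Int.toNat_of_nonneg (by linarith)
    exact_mod_cast this
  have h2 : (n : ℝ) / m - 1 ≤ (q.toNat : ℝ) := by
    have hq' : ((q.toNat : ℕ) : ℤ) = q := Int.toNat_of_nonneg hq0
    have hq'' : (q.toNat : ℝ) = (q : ℝ) := by exact_mod_cast hq'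
    rw [hq'', div_sub_one (by exact_mod_cast hm.ne'), div_le_iff₀ (by exact_mod_cast hm)]
    have : n - m < q * m := by
      have := Int.lt_ediv_add_one_mul_self n hm0  -- n < (n / m + 1) * m
      nlinarith
    have : ((n - m : ℤ) : ℝ) ≤ ((q * m : ℤ) : ℝ) := by exact_mod_cast this.le
    push_cast at this
    linarith
  calc ((Finset.Icc lo hi).card : ℝ) / m - 1 = (n : ℝ) / m - 1 := by rw [h1]
    _ ≤ q.toNat := h2
    _ ≤ _ := by exact_mod_cast hcard

/-- The number of elements of a product set satisfying `P` is the sum over the first factor of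
the fibre counts. [folklore] -/
theorem card_filter_product_eq_sum {α β : Type*} (I : Finset α) (J : Finset β)
    (P : α × β → Prop) [DecidablePred P] :
    ((I ×ˢ J).filter P).card = ∑ a ∈ I, (J.filter (fun b ↦ P (a, b))).card := by
  classical
  rw [Finset.card_filter, Finset.sum_product]
  refine Finset.sum_congr rfl fun a _ ↦ ?_
  rw [Finset.card_filter]

/-- `p² ∣ x * y` and `p ∤ x` imply `p² ∣ y`, for a prime `p`. [folklore] -/
theorem sq_dvd_of_sq_dvd_mul_of_not_dvd {p x y : ℤ} (hp : Prime p) (h : p ^ 2 ∣ x * y)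
    (hx : ¬ p ∣ x) : p ^ 2 ∣ y := by
  have h1 : p ∣ x * y := (dvd_pow_self p two_ne_zero).trans h
  have hy : p ∣ y := (hp.dvd_or_dvd h1).resolve_left hx
  obtain ⟨y', rfl⟩ := hy
  have h2 : p * p ∣ p * (x * y') := by
    have : x * (p * y') = p * (x * y') := by ring
    rw [← sq, ← this]; exact h
  have h3 : p ∣ x * y' := (mul_dvd_mul_iff_left hp.ne_zero).mp h2
  have h4 : p ∣ y' := (hp.dvd_or_dvd h3).resolve_left hx
  obtain ⟨y'', rfl⟩ := h4
  exact ⟨y'', by ring⟩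

/-- Coprime moduli: `a ∣ z` and `b ∣ z` with `a, b` coprime naturals give `ab ∣ z`. [folklore] -/
theorem natCast_mul_dvd_of_coprime {a b : ℕ} (h : a.Coprime b) {z : ℤ} (ha : (a : ℤ) ∣ z)
    (hb : (b : ℤ) ∣ z) : ((a * b : ℕ) : ℤ) ∣ z := by
  rw [Int.natCast_dvd] at ha hb ⊢
  exact h.mul_dvd_of_dvd_of_dvd ha hb

end Literature.NumberTheory.EllipticCurves.RankZeroSieve

namespace Literature.NumberTheory.EllipticCurves.RankZeroSieve

open Finset

/-! ### Local counts for `D(A,B) = 4A³ + 27B²` -/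

/-- `D(A, B) = 4A³ + 27B² = -Disc(x³ + Ax + B)`; the discriminant of `E_{A,B}` is `-16·D(A,B)`.
[folklore] -/
def negDisc (AB : ℤ × ℤ) : ℤ := 4 * AB.1 ^ 3 + 27 * AB.2 ^ 2

/-- `negDisc (A, B) = 4A³ + 27B²`. [folklore] -/
theorem negDisc_apply (A B : ℤ) : negDisc (A, B) = 4 * A ^ 3 + 27 * B ^ 2 := rfl

/-- A prime `p ≥ 5` divides none of `2, 3, 4, 27`. [folklore] -/
theorem not_dvd_small_of_five_le {p : ℕ} (hp : p.Prime) (hp5 : 5 ≤ p) :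
    ¬ (p : ℤ) ∣ 2 ∧ ¬ (p : ℤ) ∣ 4 ∧ ¬ (p : ℤ) ∣ 27 := by
  refine ⟨?_, ?_, ?_⟩ <;>
  · rw [Int.natCast_dvd]
    intro h
    have hle := Nat.le_of_dvd (by norm_num) h
    interval_cases p <;> simp_all (config := {decide := true})

/-- Two solutions `B, B'` of `p² ∣ 4A³ + 27B²` with `p ∤ A` (`p ≥ 5` prime) satisfy
`p² ∣ B - B'` or `p² ∣ B + B'`. [folklore] -/
theorem sq_dvd_sub_or_sq_dvd_add {p : ℕ} (hp : p.Prime) (hp5 : 5 ≤ p) {A B B' : ℤ}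
    (hA : ¬ (p : ℤ) ∣ A) (hB : (p : ℤ) ^ 2 ∣ negDisc (A, B))
    (hB' : (p : ℤ) ^ 2 ∣ negDisc (A, B')) :
    (p : ℤ) ^ 2 ∣ B - B' ∨ (p : ℤ) ^ 2 ∣ B + B' := by
  have hp' : Prime (p : ℤ) := Nat.prime_iff_prime_int.mp hp
  obtain ⟨h2, h4, h27⟩ := not_dvd_small_of_five_le hp hp5
  rw [negDisc_apply] at hB hB'
  -- p ∤ B
  have hpB : ¬ (p : ℤ) ∣ B := by
    intro h
    have h1 : (p : ℤ) ∣ 4 * A ^ 3 + 27 * B ^ 2 := (dvd_pow_self (p : ℤ) two_ne_zero).trans hB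
    have h3 : (p : ℤ) ∣ 4 * A ^ 3 := by
      have : (p : ℤ) ∣ 27 * B ^ 2 := Dvd.dvd.mul_left (dvd_pow h two_ne_zero) 27
      exact (dvd_add_right this).mp (by simpa [add_comm] using h1)
    rcases hp'.dvd_or_dvd h3 with h | h
    · exact h4 h
    · exact hA (hp'.dvd_of_dvd_pow h)
  have hdiff : (p : ℤ) ^ 2 ∣ 27 * ((B - B') * (B + B')) := by
    have : 27 * ((B - B') * (B + B')) = (4 * A ^ 3 + 27 * B ^ 2) - (4 * A ^ 3 + 27 * B' ^ 2) := by
      ring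
    rw [this]; exact dvd_sub hB hB'
  have hprod : (p : ℤ) ^ 2 ∣ (B - B') * (B + B') := sq_dvd_of_sq_dvd_mul_of_not_dvd hp' hdiff h27
  by_cases hsub : (p : ℤ) ∣ B - B'
  · -- then p ∤ B + B'
    have hadd : ¬ (p : ℤ) ∣ B + B' := by
      intro hadd
      have : (p : ℤ) ∣ 2 * B := by
        have : 2 * B = (B - B') + (B + B') := by ring
        rw [this]; exact dvd_add hsub hadd
      rcases hp'.dvd_or_dvd this with h | h
      · exact h2 h
      · exact hpB h
    left
    exact sq_dvd_of_sq_dvd_mul_of_not_dvd hp' (by rwa [mul_comm] at hprod) hadd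
  · right
    exact sq_dvd_of_sq_dvd_mul_of_not_dvd hp' hprod hsub

/-- Residue classes have pairwise differences divisible by the modulus. [folklore] -/
theorem dvd_sub_of_modEq_of_modEq {N : ℕ} {x y r : ℤ} (hx : x ≡ r [ZMOD N]) (hy : y ≡ r [ZMOD N]) :
    (N : ℤ) ∣ x - y :=
  Int.ModEq.dvd (hy.trans hx.symm)

/-- For `p ≥ 5` prime, `p ∤ A`, `N` coprime to `p`: the `B ∈ [j₁, j₂]` with `B ≡ b₀ (mod N)` and
`p² ∣ 4A³ + 27B²` number at most `2(#[j₁, j₂]/(N p²) + 1)` (they lie in two residue classes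
modulo `N p²`). [folklore] -/
theorem card_filter_sq_dvd_le_of_not_dvd {p : ℕ} (hp : p.Prime) (hp5 : 5 ≤ p) {N : ℕ}
    (hN : 0 < N) (hpN : N.Coprime p) {A : ℤ} (hA : ¬ (p : ℤ) ∣ A) (j₁ j₂ b₀ : ℤ) :
    ((((Icc j₁ j₂).filter
        (fun B ↦ B ≡ b₀ [ZMOD N] ∧ (p : ℤ) ^ 2 ∣ negDisc (A, B))).card : ℕ) : ℝ) ≤
      2 * (((Icc j₁ j₂).card : ℝ) / (N * p ^ 2) + 1) := by
  set S := (Icc j₁ j₂).filter (fun B ↦ B ≡ b₀ [ZMOD N] ∧ (p : ℤ) ^ 2 ∣ negDisc (A, B))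
    with hS
  rcases S.eq_empty_or_nonempty with h | ⟨B₁, hB₁⟩
  · rw [h]; simp only [card_empty, Nat.cast_zero]; positivity
  have hmem : ∀ B ∈ S, (j₁ ≤ B ∧ B ≤ j₂) ∧ B ≡ b₀ [ZMOD N] ∧ (p : ℤ) ^ 2 ∣ negDisc (A, B) := by
    intro B hB
    simpa [hS, mem_filter, mem_Icc] using hB
  set S₁ := S.filter (fun B ↦ (p : ℤ) ^ 2 ∣ B - B₁) with hS₁
  set S₂ := S.filter (fun B ↦ (p : ℤ) ^ 2 ∣ B + B₁) with hS₂
  have hcover : S ⊆ S₁ ∪ S₂ := by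
    intro B hB
    rcases sq_dvd_sub_or_sq_dvd_add hp hp5 hA (hmem B hB).2.2 (hmem B₁ hB₁).2.2 with h | h
    · exact mem_union.mpr (Or.inl (mem_filter.mpr ⟨hB, h⟩))
    · exact mem_union.mpr (Or.inr (mem_filter.mpr ⟨hB, h⟩))
  have hm : 0 < N * p ^ 2 := by positivity
  have hcop : N.Coprime (p ^ 2) := Nat.Coprime.pow_right 2 hpN
  have hcast : (((N * p ^ 2 : ℕ) : ℝ)) = (N : ℝ) * p ^ 2 := by push_cast; ring
  have h1 : (S₁.card : ℝ) ≤ ((Icc j₁ j₂).card : ℝ) / (N * p ^ 2) + 1 := by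
    rw [← hcast]
    refine card_le_of_forall_dvd_sub hm (fun x hx ↦ (hmem x (mem_filter.mp hx).1).1) ?_
    intro x hx y hy
    have hx' := mem_filter.mp hx; have hy' := mem_filter.mp hy
    refine natCast_mul_dvd_of_coprime hcop (dvd_sub_of_modEq_of_modEq (hmem x hx'.1).2.1
      (hmem y hy'.1).2.1) ?_
    have : x - y = (x - B₁) - (y - B₁) := by ring
    rw [this]; push_cast; exact dvd_sub hx'.2 hy'.2
  have h2 : (S₂.card : ℝ) ≤ ((Icc j₁ j₂).card : ℝ) / (N * p ^ 2) + 1 := by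
    rw [← hcast]
    refine card_le_of_forall_dvd_sub hm (fun x hx ↦ (hmem x (mem_filter.mp hx).1).1) ?_
    intro x hx y hy
    have hx' := mem_filter.mp hx; have hy' := mem_filter.mp hy
    refine natCast_mul_dvd_of_coprime hcop (dvd_sub_of_modEq_of_modEq (hmem x hx'.1).2.1
      (hmem y hy'.1).2.1) ?_
    have : x - y = (x + B₁) - (y + B₁) := by ring
    rw [this]; push_cast; exact dvd_sub hx'.2 hy'.2
  have h3 : S.card ≤ S₁.card + S₂.card := (card_le_card hcover).trans (card_union_le _ _)
  have h3' : (S.card : ℝ) ≤ S₁.card + S₂.card := by exact_mod_cast h3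
  linarith

/-- For `p ≥ 5` prime with `p ∣ A` and `N` coprime to `p`: the `B ∈ [j₁, j₂]` with
`B ≡ b₀ (mod N)` and `p² ∣ 4A³ + 27B²` are divisible by `p`, so number at most
`#[j₁, j₂]/(N p) + 1`. [folklore] -/
theorem card_filter_sq_dvd_le_of_dvd {p : ℕ} (hp : p.Prime) (hp5 : 5 ≤ p) {N : ℕ}
    (hN : 0 < N) (hpN : N.Coprime p) {A : ℤ} (hA : (p : ℤ) ∣ A) (j₁ j₂ b₀ : ℤ) :
    ((((Icc j₁ j₂).filter
        (fun B ↦ B ≡ b₀ [ZMOD N] ∧ (p : ℤ) ^ 2 ∣ negDisc (A, B))).card : ℕ) : ℝ) ≤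
      ((Icc j₁ j₂).card : ℝ) / (N * p) + 1 := by
  have hp' : Prime (p : ℤ) := Nat.prime_iff_prime_int.mp hp
  obtain ⟨h2, h4, h27⟩ := not_dvd_small_of_five_le hp hp5
  set S := (Icc j₁ j₂).filter (fun B ↦ B ≡ b₀ [ZMOD N] ∧ (p : ℤ) ^ 2 ∣ negDisc (A, B))
    with hS
  have hmem : ∀ B ∈ S, (j₁ ≤ B ∧ B ≤ j₂) ∧ B ≡ b₀ [ZMOD N] ∧ (p : ℤ) ∣ B := by
    intro B hB
    have hB' : (j₁ ≤ B ∧ B ≤ j₂) ∧ B ≡ b₀ [ZMOD N] ∧ (p : ℤ) ^ 2 ∣ negDisc (A, B) := by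
      simpa [hS, mem_filter, mem_Icc] using hB
    refine ⟨hB'.1, hB'.2.1, ?_⟩
    have h1 : (p : ℤ) ∣ 4 * A ^ 3 + 27 * B ^ 2 :=
      (dvd_pow_self (p : ℤ) two_ne_zero).trans (negDisc_apply A B ▸ hB'.2.2)
    have h3 : (p : ℤ) ∣ 27 * B ^ 2 := by
      have : (p : ℤ) ∣ 4 * A ^ 3 := Dvd.dvd.mul_left (dvd_pow hA three_ne_zero) 4
      exact (dvd_add_right this).mp h1
    rcases hp'.dvd_or_dvd h3 with h | h
    · exact absurd h h27
    · exact hp'.dvd_of_dvd_pow h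
  have hm : 0 < N * p := by positivity
  have hcast : (((N * p : ℕ) : ℝ)) = (N : ℝ) * p := by push_cast; ring
  rw [← hcast]
  refine card_le_of_forall_dvd_sub hm (fun x hx ↦ (hmem x hx).1) ?_
  intro x hx y hy
  refine natCast_mul_dvd_of_coprime hpN (dvd_sub_of_modEq_of_modEq (hmem x hx).2.1
    (hmem y hy).2.1) (dvd_sub (hmem x hx).2.2 (hmem y hy).2.2)

end Literature.NumberTheory.EllipticCurves.RankZeroSieve

namespace Literature.NumberTheory.EllipticCurves.RankZeroSieve

open Finset

/-- Elements of `[i₁, i₂]` in a residue class mod `N`, avoiding / lying in `p ℤ`: counts. [folklore] -/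
theorem card_filter_modEq_le {N : ℕ} (hN : 0 < N) (i₁ i₂ a₀ : ℤ) (q : ℤ → Prop)
    [DecidablePred q] :
    ((((Icc i₁ i₂).filter (fun A ↦ A ≡ a₀ [ZMOD N] ∧ q A)).card : ℕ) : ℝ) ≤
      ((Icc i₁ i₂).card : ℝ) / N + 1 := by
  refine card_le_of_forall_dvd_sub hN (fun x hx ↦ mem_Icc.mp (mem_filter.mp hx).1)
    (fun x hx y hy ↦ ?_)
  exact dvd_sub_of_modEq_of_modEq (mem_filter.mp hx).2.1 (mem_filter.mp hy).2.1

/-- Elements of `[i₁, i₂]` in a residue class mod `N` and divisible by `p` coprime to `N`.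
[folklore] -/
theorem card_filter_modEq_dvd_le {N : ℕ} (hN : 0 < N) {p : ℕ} (hp : 0 < p) (hpN : N.Coprime p)
    (i₁ i₂ a₀ : ℤ) :
    ((((Icc i₁ i₂).filter (fun A ↦ A ≡ a₀ [ZMOD N] ∧ (p : ℤ) ∣ A)).card : ℕ) : ℝ) ≤
      ((Icc i₁ i₂).card : ℝ) / (N * p) + 1 := by
  have hcast : (((N * p : ℕ) : ℝ)) = (N : ℝ) * p := by push_cast; ring
  rw [← hcast]
  refine card_le_of_forall_dvd_sub (by positivity)
    (fun x hx ↦ mem_Icc.mp (mem_filter.mp hx).1) (fun x hx y hy ↦ ?_)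
  exact natCast_mul_dvd_of_coprime hpN
    (dvd_sub_of_modEq_of_modEq (mem_filter.mp hx).2.1 (mem_filter.mp hy).2.1)
    (dvd_sub (mem_filter.mp hx).2.2 (mem_filter.mp hy).2.2)

/-- **Local count at a prime `p ≥ 5` coprime to `N`**: the pairs `(A, B) ∈ [i₁,i₂] × [j₁,j₂]` in
the class of `(a₀, b₀)` mod `N` with `p² ∣ 4A³ + 27B²` number at most
`2(#I/N + 1)(#J/(Np²) + 1) + (#I/(Np) + 1)(#J/(Np) + 1)` (split according to `p ∤ A`, `p ∣ A`).
[folklore] -/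
theorem card_filter_class_sq_dvd_le {p : ℕ} (hp : p.Prime) (hp5 : 5 ≤ p) {N : ℕ} (hN : 0 < N)
    (hpN : N.Coprime p) (i₁ i₂ j₁ j₂ a₀ b₀ : ℤ) :
    ((((Icc i₁ i₂ ×ˢ Icc j₁ j₂).filter (fun AB ↦ (AB.1 ≡ a₀ [ZMOD N] ∧ AB.2 ≡ b₀ [ZMOD N]) ∧
        (p : ℤ) ^ 2 ∣ negDisc AB)).card : ℕ) : ℝ) ≤
      2 * (((Icc i₁ i₂).card : ℝ) / N + 1) * (((Icc j₁ j₂).card : ℝ) / (N * p ^ 2) + 1) +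
        (((Icc i₁ i₂).card : ℝ) / (N * p) + 1) * (((Icc j₁ j₂).card : ℝ) / (N * p) + 1) := by
  rw [card_filter_product_eq_sum]
  set I := Icc i₁ i₂ with hI
  set J := Icc j₁ j₂ with hJ
  set f : ℤ → ℕ := fun A ↦ (J.filter (fun B ↦ (A ≡ a₀ [ZMOD N] ∧ B ≡ b₀ [ZMOD N]) ∧
    (p : ℤ) ^ 2 ∣ negDisc (A, B))).card with hf
  have hzero : ∀ A ∈ I.filter (fun A ↦ ¬ A ≡ a₀ [ZMOD N]), f A = 0 := by
    intro A hA
    have hA' := (mem_filter.mp hA).2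
    simp only [hf, card_eq_zero, filter_eq_empty_iff]
    intro B _ h
    exact hA' h.1.1
  set I₁ := I.filter (fun A ↦ A ≡ a₀ [ZMOD N] ∧ ¬ (p : ℤ) ∣ A) with hI₁
  set I₂ := I.filter (fun A ↦ A ≡ a₀ [ZMOD N] ∧ (p : ℤ) ∣ A) with hI₂
  have hsplit : ∑ A ∈ I, f A = ∑ A ∈ I₁, f A + ∑ A ∈ I₂, f A := by
    rw [← sum_filter_add_sum_filter_not I (fun A ↦ A ≡ a₀ [ZMOD N]) f,
      sum_eq_zero hzero, add_zero,
      ← sum_filter_add_sum_filter_not (I.filter (fun A ↦ A ≡ a₀ [ZMOD N]))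
        (fun A ↦ ¬ (p : ℤ) ∣ A) f, filter_filter, filter_filter]
    simp only [not_not, hI₁, hI₂]
  have hb1 : ∀ A ∈ I₁, (f A : ℝ) ≤ 2 * ((J.card : ℝ) / (N * p ^ 2) + 1) := by
    intro A hA
    obtain ⟨_, hA1, hA2⟩ := mem_filter.mp hA
    have : f A = (J.filter (fun B ↦ B ≡ b₀ [ZMOD N] ∧ (p : ℤ) ^ 2 ∣ negDisc (A, B))).card := by
      simp only [hf]
      congr 1
      exact filter_congr (fun B _ ↦ by simp [hA1])
    rw [this]
    exact card_filter_sq_dvd_le_of_not_dvd hp hp5 hN hpN hA2 j₁ j₂ b₀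
  have hb2 : ∀ A ∈ I₂, (f A : ℝ) ≤ (J.card : ℝ) / (N * p) + 1 := by
    intro A hA
    obtain ⟨_, hA1, hA2⟩ := mem_filter.mp hA
    have : f A = (J.filter (fun B ↦ B ≡ b₀ [ZMOD N] ∧ (p : ℤ) ^ 2 ∣ negDisc (A, B))).card := by
      simp only [hf]
      congr 1
      exact filter_congr (fun B _ ↦ by simp [hA1])
    rw [this]
    exact card_filter_sq_dvd_le_of_dvd hp hp5 hN hpN hA2 j₁ j₂ b₀
  have hc1 : (I₁.card : ℝ) ≤ (I.card : ℝ) / N + 1 := card_filter_modEq_le hN i₁ i₂ a₀ _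
  have hc2 : (I₂.card : ℝ) ≤ (I.card : ℝ) / (N * p) + 1 :=
    card_filter_modEq_dvd_le hN hp.pos hpN i₁ i₂ a₀
  have hJ0 : (0 : ℝ) ≤ (J.card : ℝ) / (N * p ^ 2) + 1 := by positivity
  have hJ0' : (0 : ℝ) ≤ (J.card : ℝ) / (N * p) + 1 := by positivity
  have hs1 : (((∑ A ∈ I₁, f A : ℕ)) : ℝ) ≤ ((I.card : ℝ) / N + 1) * (2 * ((J.card : ℝ) / (N * p ^ 2) + 1)) := by
    push_cast
    calc ∑ A ∈ I₁, (f A : ℝ) ≤ ∑ A ∈ I₁, 2 * ((J.card : ℝ) / (N * p ^ 2) + 1) := sum_le_sum hb1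
      _ = I₁.card * (2 * ((J.card : ℝ) / (N * p ^ 2) + 1)) := by rw [sum_const, nsmul_eq_mul]
      _ ≤ _ := by gcongr
  have hs2 : (((∑ A ∈ I₂, f A : ℕ)) : ℝ) ≤ ((I.card : ℝ) / (N * p) + 1) * ((J.card : ℝ) / (N * p) + 1) := by
    push_cast
    calc ∑ A ∈ I₂, (f A : ℝ) ≤ ∑ A ∈ I₂, ((J.card : ℝ) / (N * p) + 1) := sum_le_sum hb2
      _ = I₂.card * ((J.card : ℝ) / (N * p) + 1) := by rw [sum_const, nsmul_eq_mul]
      _ ≤ _ := by gcongr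
  rw [hsplit, Nat.cast_add]
  linarith

/-- `9 ∣ 4A³ + 27B²` forces `3 ∣ A`. [folklore] -/
theorem three_dvd_of_nine_dvd_negDisc {A B : ℤ} (h : (9 : ℤ) ∣ negDisc (A, B)) : (3 : ℤ) ∣ A := by
  rw [negDisc_apply] at h
  have h3 : (3 : ℤ) ∣ 4 * A ^ 3 := by
    have h1 : (3 : ℤ) ∣ 4 * A ^ 3 + 27 * B ^ 2 := (by norm_num : (3:ℤ) ∣ 9).trans h
    have h2 : (3 : ℤ) ∣ 27 * B ^ 2 := Dvd.dvd.mul_right (by norm_num) _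
    exact (dvd_add_left h2).mp h1
  have hp : Prime (3 : ℤ) := Int.prime_three
  rcases hp.dvd_or_dvd h3 with h | h
  · norm_num at h
  · exact hp.dvd_of_dvd_pow h

/-- **Local count at `p = 3`** (for `3 ∤ N`): pairs in the class with `9 ∣ 4A³ + 27B²` have
`3 ∣ A`, so number at most `(#I/(3N) + 1)(#J/N + 1)`. [folklore] -/
theorem card_filter_class_nine_dvd_le {N : ℕ} (hN : 0 < N) (h3N : N.Coprime 3)
    (i₁ i₂ j₁ j₂ a₀ b₀ : ℤ) :
    ((((Icc i₁ i₂ ×ˢ Icc j₁ j₂).filter (fun AB ↦ (AB.1 ≡ a₀ [ZMOD N] ∧ AB.2 ≡ b₀ [ZMOD N]) ∧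
        ((3 : ℕ) : ℤ) ^ 2 ∣ negDisc AB)).card : ℕ) : ℝ) ≤
      (((Icc i₁ i₂).card : ℝ) / (N * 3) + 1) * (((Icc j₁ j₂).card : ℝ) / N + 1) := by
  have hsub : (Icc i₁ i₂ ×ˢ Icc j₁ j₂).filter (fun AB ↦ (AB.1 ≡ a₀ [ZMOD N] ∧ AB.2 ≡ b₀ [ZMOD N]) ∧
        ((3 : ℕ) : ℤ) ^ 2 ∣ negDisc AB) ⊆
      (Icc i₁ i₂).filter (fun A ↦ A ≡ a₀ [ZMOD N] ∧ ((3 : ℕ) : ℤ) ∣ A) ×ˢ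
        (Icc j₁ j₂).filter (fun B ↦ B ≡ b₀ [ZMOD N] ∧ True) := by
    intro AB hAB
    obtain ⟨hmem, ⟨hA, hB⟩, h9⟩ := mem_filter.mp hAB
    obtain ⟨hA', hB'⟩ := mem_product.mp hmem
    refine mem_product.mpr ⟨mem_filter.mpr ⟨hA', hA, ?_⟩, mem_filter.mpr ⟨hB', hB, trivial⟩⟩
    have : (9 : ℤ) ∣ negDisc (AB.1, AB.2) := by simpa using h9
    exact_mod_cast three_dvd_of_nine_dvd_negDisc this
  have h1 := card_le_card hsub
  rw [card_product] at h1
  have h2 : ((((Icc i₁ i₂).filter (fun A ↦ A ≡ a₀ [ZMOD N] ∧ ((3 : ℕ) : ℤ) ∣ A)).card : ℕ) : ℝ) ≤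
      ((Icc i₁ i₂).card : ℝ) / (N * 3) + 1 := by
    have := card_filter_modEq_dvd_le hN (by norm_num : 0 < 3) h3N i₁ i₂ a₀
    exact_mod_cast this
  have h3 : ((((Icc j₁ j₂).filter (fun B ↦ B ≡ b₀ [ZMOD N] ∧ True)).card : ℕ) : ℝ) ≤
      ((Icc j₁ j₂).card : ℝ) / N + 1 := card_filter_modEq_le hN j₁ j₂ b₀ _
  calc _ ≤ ((((Icc i₁ i₂).filter (fun A ↦ A ≡ a₀ [ZMOD N] ∧ ((3 : ℕ) : ℤ) ∣ A)).card *
        ((Icc j₁ j₂).filter (fun B ↦ B ≡ b₀ [ZMOD N] ∧ True)).card : ℕ) : ℝ) := by exact_mod_cast h1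
    _ = _ * _ := by push_cast; ring
    _ ≤ _ := mul_le_mul h2 h3 (by positivity) (by positivity)

/-- **The class count from below**: at least `(#I/N - 1)(#J/N - 1)` pairs of `[i₁,i₂] × [j₁,j₂]`
lie in the class of `(a₀, b₀)` modulo `N` (when `#I, #J ≥ N`). [folklore] -/
theorem le_card_filter_class {N : ℕ} (hN : 0 < N) (i₁ i₂ j₁ j₂ a₀ b₀ : ℤ)
    (hI : (N : ℝ) ≤ (Icc i₁ i₂).card) (hJ : (N : ℝ) ≤ (Icc j₁ j₂).card) :
    (((Icc i₁ i₂).card : ℝ) / N - 1) * (((Icc j₁ j₂).card : ℝ) / N - 1) ≤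
      ((((Icc i₁ i₂ ×ˢ Icc j₁ j₂).filter
        (fun AB ↦ AB.1 ≡ a₀ [ZMOD N] ∧ AB.2 ≡ b₀ [ZMOD N])).card : ℕ) : ℝ) := by
  rw [Finset.filter_product (s := Icc i₁ i₂) (t := Icc j₁ j₂) (p := fun A ↦ A ≡ a₀ [ZMOD N])
    (q := fun B ↦ B ≡ b₀ [ZMOD N]), card_product, Nat.cast_mul]
  have hN0 : (0 : ℝ) < N := by exact_mod_cast hN
  have h1 := le_card_filter_modEq i₁ i₂ a₀ hN
  have h2 := le_card_filter_modEq j₁ j₂ b₀ hN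
  have h0 : (0 : ℝ) ≤ ((Icc i₁ i₂).card : ℝ) / N - 1 := by
    rw [sub_nonneg, le_div_iff₀ hN0]; linarith
  have h0' : (0 : ℝ) ≤ ((Icc j₁ j₂).card : ℝ) / N - 1 := by
    rw [sub_nonneg, le_div_iff₀ hN0]; linarith
  exact mul_le_mul h1 h2 h0' (h0.trans h1)

end Literature.NumberTheory.EllipticCurves.RankZeroSieve


namespace Literature.NumberTheory.EllipticCurves.RankZeroSieve

open Finset
open scoped Classical

/-! ### Sums over primes -/

/-- The primes in `[a, b]`. [folklore] -/
def primesIcc (a b : ℕ) : Finset ℕ := (Finset.Icc a b).filter Nat.Prime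

/-- Membership in `primesIcc`. [folklore] -/
theorem mem_primesIcc {a b p : ℕ} : p ∈ primesIcc a b ↔ (a ≤ p ∧ p ≤ b) ∧ p.Prime := by
  simp [primesIcc]

/-- `∑_{k=2}^{K} 1/(2k+1)² ≤ 1/8 - 1/(4(K+1))` for `K ≥ 1` (telescoping:
`1/(2k+1)² ≤ 1/(4k) - 1/(4(k+1))`). [folklore] -/
theorem sum_Icc_inv_odd_sq_le' (K : ℕ) (hK : 1 ≤ K) :
    ∑ k ∈ Icc 2 K, (1 : ℝ) / (2 * (k : ℝ) + 1) ^ 2 ≤ 1 / 8 - 1 / (4 * ((K : ℝ) + 1)) := by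
  induction K, hK using Nat.le_induction with
  | base => norm_num
  | succ K hK ih =>
    rw [Finset.sum_Icc_succ_top (by omega), Nat.cast_succ]
    have hK1 : (1 : ℝ) ≤ K := by exact_mod_cast hK
    have key : (1 : ℝ) / (2 * ((K : ℝ) + 1) + 1) ^ 2 ≤
        1 / (4 * ((K : ℝ) + 1)) - 1 / (4 * ((K : ℝ) + 1 + 1)) := by
      rw [div_sub_div _ _ (by positivity) (by positivity),
        div_le_div_iff₀ (by positivity) (by positivity)]
      nlinarith [sq_nonneg ((K : ℝ) + 1)]
    linarith

/-- `∑_{k=2}^{K} 1/(2k+1)² ≤ 1/8`. [folklore] -/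
theorem sum_Icc_inv_odd_sq_le (K : ℕ) :
    ∑ k ∈ Icc 2 K, (1 : ℝ) / (2 * (k : ℝ) + 1) ^ 2 ≤ 1 / 8 := by
  rcases Nat.eq_zero_or_pos K with rfl | hK
  · simp
  have := sum_Icc_inv_odd_sq_le' K hK
  have h0 : (0 : ℝ) ≤ 1 / (4 * ((K : ℝ) + 1)) := by positivity
  linarith

/-- `∑_{5 ≤ p ≤ P, p prime} 1/p² ≤ 1/8` (primes `≥ 5` are odd). [folklore] -/
theorem sum_primesIcc_five_inv_sq_le (P : ℕ) :
    ∑ p ∈ primesIcc 5 P, (1 : ℝ) / (p : ℝ) ^ 2 ≤ 1 / 8 := by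
  have hsub : primesIcc 5 P ⊆ (Icc 2 (P / 2)).image (fun k : ℕ ↦ (2 * k + 1 : ℕ)) := by
    intro p hp
    obtain ⟨⟨h5, hP⟩, hpr⟩ := mem_primesIcc.mp hp
    rw [mem_image]
    refine ⟨p / 2, mem_Icc.mpr ⟨by omega, Nat.div_le_div_right hP⟩, ?_⟩
    have hodd : Odd p := hpr.odd_of_ne_two (by omega)
    obtain ⟨k, hk⟩ := hodd
    omega
  have hinj : Set.InjOn (fun k : ℕ ↦ (2 * k + 1 : ℕ)) (Icc 2 (P / 2) : Finset ℕ) := by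
    intro a _ b _ h; simp only at h; omega
  calc ∑ p ∈ primesIcc 5 P, (1 : ℝ) / (p : ℝ) ^ 2
      ≤ ∑ p ∈ (Icc 2 (P / 2)).image (fun k : ℕ ↦ (2 * k + 1 : ℕ)), (1 : ℝ) / (p : ℝ) ^ 2 :=
        sum_le_sum_of_subset_of_nonneg hsub (fun _ _ _ ↦ by positivity)
    _ = ∑ k ∈ Icc 2 (P / 2), (1 : ℝ) / (2 * (k : ℝ) + 1) ^ 2 := by
        rw [sum_image hinj]
        refine sum_congr rfl fun k _ ↦ ?_
        push_cast; ring
    _ ≤ 1 / 8 := sum_Icc_inv_odd_sq_le _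

/-- `H_P = ∑_{n=1}^{P} 1/n`. [folklore] -/
noncomputable def harmonicR (P : ℕ) : ℝ := ∑ n ∈ Icc 1 P, (1 : ℝ) / n

/-- `H_P ≥ 0`. [folklore] -/
theorem harmonicR_nonneg (P : ℕ) : 0 ≤ harmonicR P :=
  sum_nonneg fun _ _ ↦ by positivity

/-- `H_P ≤ 1 + log P` (Mathlib's `harmonic_le_one_add_log`). [folklore] -/
theorem harmonicR_le (P : ℕ) : harmonicR P ≤ 1 + Real.log P := by
  have h := harmonic_le_one_add_log P
  have : ((harmonic P : ℚ) : ℝ) = harmonicR P := by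
    rw [harmonic_eq_sum_Icc, harmonicR]
    push_cast
    refine sum_congr rfl fun n _ ↦ ?_
    rw [one_div]
  linarith

/-- `∑_{a ≤ p ≤ P prime} 1/p ≤ H_P` for `a ≥ 1`. [folklore] -/
theorem sum_primesIcc_inv_le {a : ℕ} (ha : 1 ≤ a) (P : ℕ) :
    ∑ p ∈ primesIcc a P, (1 : ℝ) / p ≤ harmonicR P := by
  refine sum_le_sum_of_subset_of_nonneg (fun p hp ↦ ?_) (fun _ _ _ ↦ by positivity)
  obtain ⟨⟨h1, h2⟩, _⟩ := mem_primesIcc.mp hp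
  exact mem_Icc.mpr ⟨ha.trans h1, h2⟩

/-- `#{a ≤ p ≤ P prime} ≤ π(P)`. [folklore] -/
theorem card_primesIcc_le (a P : ℕ) : (primesIcc a P).card ≤ Nat.primeCounting P := by
  rw [← Nat.primesLE_card_eq_primeCounting]
  refine card_le_card fun p hp ↦ ?_
  obtain ⟨⟨_, h2⟩, hpr⟩ := mem_primesIcc.mp hp
  exact Nat.mem_primesLE.mpr ⟨h2, hpr⟩

/-! ### The finite sieve inequality -/

/-- `4A³ + 27B²` is divisible by the square of no odd prime ("squarefree away from `2`", the
second condition of the source's §4.1 family). [cite: BhargavaShankarTernary2015, §4.1 (arXiv v2)] -/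
def OddSqfree (AB : ℤ × ℤ) : Prop := ∀ p : ℕ, p.Prime → p ≠ 2 → ¬ (p : ℤ) ^ 2 ∣ negDisc AB

/-- `negDisc` respects congruences. [folklore] -/
theorem negDisc_modEq {m A B a b : ℤ} (hA : A ≡ a [ZMOD m]) (hB : B ≡ b [ZMOD m]) :
    negDisc (A, B) ≡ negDisc (a, b) [ZMOD m] := by
  simp only [negDisc_apply]
  exact ((hA.pow 3).mul_left 4).add ((hB.pow 2).mul_left 27)

/-- Expansion of the local bound at `p ≥ 1` (with `N ≥ 1`). [folklore] -/
theorem local_bound_expand {I J N p : ℝ} (hI : 0 ≤ I) (hJ : 0 ≤ J) (hN : 1 ≤ N) (hp : 1 ≤ p) :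
    2 * (I / N + 1) * (J / (N * p ^ 2) + 1) + (I / (N * p) + 1) * (J / (N * p) + 1) ≤
      (3 * I * J / N ^ 2 + 2 * J) * (1 / p ^ 2) + (I + J) * (1 / p) + (2 * I + 3) := by
  have hN0 : 0 < N := by linarith
  have hp0 : 0 < p := by linarith
  have expand : 2 * (I / N + 1) * (J / (N * p ^ 2) + 1) + (I / (N * p) + 1) * (J / (N * p) + 1) =
      (2 * (I / N) * (J / (N * p ^ 2)) + I / (N * p) * (J / (N * p))) +
        (2 * (I / N) + 2 * (J / (N * p ^ 2)) + I / (N * p) + J / (N * p) + 3) := by ring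
  have e : 2 * (I / N) * (J / (N * p ^ 2)) + I / (N * p) * (J / (N * p)) =
      3 * I * J / N ^ 2 * (1 / p ^ 2) := by
    field_simp; ring
  have h1 : I / N ≤ I := div_le_self hI hN
  have h2 : J / (N * p ^ 2) ≤ J * (1 / p ^ 2) := by
    rw [mul_one_div]; exact div_le_div_of_nonneg_left hJ (by positivity) (by nlinarith)
  have h3 : I / (N * p) ≤ I * (1 / p) := by
    rw [mul_one_div]; exact div_le_div_of_nonneg_left hI (by positivity) (by nlinarith)
  have h4 : J / (N * p) ≤ J * (1 / p) := by
    rw [mul_one_div]; exact div_le_div_of_nonneg_left hJ (by positivity) (by nlinarith)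
  rw [expand, e]
  nlinarith

/-- **The finite sieve inequality.** For intervals `I = [i₁, i₂]`, `J = [j₁, j₂]` of lengths
`≥ N`, a class `(a₀, b₀)` modulo `N ≥ 1` compatible at the odd primes dividing `N` (each such `p`
has `p² ∣ N` and `p² ∤ 4a₀³ + 27b₀²`), and `P ≥ 3` with `|4A³ + 27B²| ≤ P²` on `I × J`: the number
of pairs in the class with `4A³ + 27B²` squarefree away from `2` is at least
`(7/24)·#I·#J/N² − (2#I + 3#J + 1) − (#I + #J)·H_P − (2#I + 3)·π(P)` (union bound over the odd
primes `p ≤ P`, `p ∤ N`, with the local proportions `1/3` at `p = 3` and `≤ 3/p²` at `p ≥ 5`, and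
`∑_{p ≥ 5} 3/p² ≤ 3/8`). [folklore] -/
theorem sieve_lower_bound (i₁ i₂ j₁ j₂ : ℤ) {N : ℕ} (hN : 0 < N) (a₀ b₀ : ℤ)
    (hcompat : ∀ p : ℕ, p.Prime → p ≠ 2 → (p : ℤ) ∣ N →
      (p : ℤ) ^ 2 ∣ N ∧ ¬ (p : ℤ) ^ 2 ∣ negDisc (a₀, b₀))
    {P : ℕ} (hP3 : 3 ≤ P) (hP : ∀ AB ∈ Icc i₁ i₂ ×ˢ Icc j₁ j₂, |negDisc AB| ≤ (P : ℤ) ^ 2)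
    (hI : (N : ℝ) ≤ (Icc i₁ i₂).card) (hJ : (N : ℝ) ≤ (Icc j₁ j₂).card) :
    (7 / 24 : ℝ) * (Icc i₁ i₂).card * (Icc j₁ j₂).card / (N : ℝ) ^ 2
      - (2 * (Icc i₁ i₂).card + 3 * (Icc j₁ j₂).card + 1)
      - ((Icc i₁ i₂).card + (Icc j₁ j₂).card) * harmonicR P
      - (2 * (Icc i₁ i₂).card + 3) * Nat.primeCounting P ≤
      ((((Icc i₁ i₂ ×ˢ Icc j₁ j₂).filter (fun AB : ℤ × ℤ ↦
        (AB.1 ≡ a₀ [ZMOD N] ∧ AB.2 ≡ b₀ [ZMOD N]) ∧ OddSqfree AB)).card : ℕ) : ℝ) := by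
  set I := Icc i₁ i₂ with hIdef
  set J := Icc j₁ j₂ with hJdef
  set cls : ℤ × ℤ → Prop := fun AB ↦ AB.1 ≡ a₀ [ZMOD N] ∧ AB.2 ≡ b₀ [ZMOD N] with hcls
  set classSet := (I ×ˢ J).filter cls with hclassSet
  set good := (I ×ˢ J).filter (fun AB ↦ cls AB ∧ OddSqfree AB) with hgood
  set bad : ℕ → Finset (ℤ × ℤ) := fun p ↦ (I ×ˢ J).filter (fun AB ↦ cls AB ∧
    (p : ℤ) ^ 2 ∣ negDisc AB) with hbad
  set S := (primesIcc 3 P).filter (fun p ↦ ¬ p ∣ N) with hS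
  -- Step 1: the cover `classSet \ good ⊆ ⋃_{p ∈ S} bad p`
  have hcover : classSet \ good ⊆ S.biUnion bad := by
    intro AB hAB
    rw [mem_sdiff] at hAB
    obtain ⟨hc, hng⟩ := hAB
    obtain ⟨hbox, hcl⟩ := mem_filter.mp hc
    have hns : ¬ OddSqfree AB := fun h ↦ hng (mem_filter.mpr ⟨hbox, hcl, h⟩)
    simp only [OddSqfree, not_forall, not_not, exists_prop] at hns
    obtain ⟨p, hp, hp2, hdvd⟩ := hns
    have hp3 : 3 ≤ p := by have := hp.two_le; omega
    have hmodN : negDisc AB ≡ negDisc (a₀, b₀) [ZMOD N] := by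
      have := negDisc_modEq hcl.1 hcl.2
      simpa using this
    by_cases hpN : p ∣ N
    · exfalso
      obtain ⟨hp2N, hnd⟩ := hcompat p hp hp2 (by exact_mod_cast hpN)
      have h1 : negDisc AB ≡ negDisc (a₀, b₀) [ZMOD (p : ℤ) ^ 2] := hmodN.of_dvd hp2N
      have h2 : (p : ℤ) ^ 2 ∣ negDisc (a₀, b₀) - negDisc AB := h1.dvd
      have h3 := dvd_add h2 hdvd
      rw [sub_add_cancel] at h3
      exact hnd h3
    by_cases hpP : p ≤ P
    · exact mem_biUnion.mpr ⟨p, mem_filter.mpr ⟨mem_primesIcc.mpr ⟨⟨hp3, hpP⟩, hp⟩, hpN⟩,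
        mem_filter.mpr ⟨hbox, hcl, hdvd⟩⟩
    · -- p > P forces negDisc AB = 0
      have hD0 : negDisc AB = 0 := by
        refine Int.eq_zero_of_abs_lt_dvd hdvd (lt_of_le_of_lt (hP AB hbox) ?_)
        have : (P : ℤ) < p := by exact_mod_cast (not_le.mp hpP)
        exact pow_lt_pow_left₀ this (by positivity) two_ne_zero
      by_cases h3N : 3 ∣ N
      · exfalso
        obtain ⟨h9N, hnd⟩ := hcompat 3 Nat.prime_three (by norm_num) (by exact_mod_cast h3N)
        have h1 : negDisc AB ≡ negDisc (a₀, b₀) [ZMOD (3 : ℤ) ^ 2] := by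
          have := hmodN.of_dvd h9N; exact_mod_cast this
        rw [hD0] at h1
        exact hnd (Int.modEq_zero_iff_dvd.mp h1.symm)
      · refine mem_biUnion.mpr ⟨3, mem_filter.mpr ⟨mem_primesIcc.mpr ⟨⟨le_rfl, hP3⟩,
          Nat.prime_three⟩, h3N⟩, mem_filter.mpr ⟨hbox, hcl, ?_⟩⟩
        rw [hD0]; exact dvd_zero _
  -- Step 2: counting
  have hcount : (classSet.card : ℝ) ≤ good.card + ∑ p ∈ S, ((bad p).card : ℝ) := by
    have h1 : classSet.card ≤ (classSet \ good).card + good.card := card_le_card_sdiff_add_card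
    have h2 : (classSet \ good).card ≤ ∑ p ∈ S, (bad p).card :=
      (card_le_card hcover).trans card_biUnion_le
    have : (classSet.card : ℝ) ≤ ((classSet \ good).card : ℝ) + good.card := by exact_mod_cast h1
    have : ((classSet \ good).card : ℝ) ≤ ∑ p ∈ S, ((bad p).card : ℝ) := by exact_mod_cast h2
    linarith
  -- the class count
  have hclass : (((I.card : ℝ) / N - 1) * ((J.card : ℝ) / N - 1)) ≤ classSet.card :=
    le_card_filter_class hN i₁ i₂ j₁ j₂ a₀ b₀ hI hJ
  -- split S into {3} and the primes ≥ 5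
  have hsplitS : ∑ p ∈ S, ((bad p).card : ℝ) =
      ∑ p ∈ S.filter (fun p ↦ p = 3), ((bad p).card : ℝ) +
        ∑ p ∈ S.filter (fun p ↦ ¬ p = 3), ((bad p).card : ℝ) :=
    (sum_filter_add_sum_filter_not S (fun p ↦ p = 3) _).symm
  have hN1 : (1 : ℝ) ≤ N := by exact_mod_cast hN
  have hI0 : (0 : ℝ) ≤ I.card := Nat.cast_nonneg _
  have hJ0 : (0 : ℝ) ≤ J.card := Nat.cast_nonneg _
  -- p = 3 part
  have h3part : ∑ p ∈ S.filter (fun p ↦ p = 3), ((bad p).card : ℝ) ≤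
      ((I.card : ℝ) / (N * 3) + 1) * ((J.card : ℝ) / N + 1) := by
    by_cases h3N : 3 ∣ N
    · have : S.filter (fun p ↦ p = 3) = ∅ := by
        rw [filter_eq_empty_iff]
        intro p hp hp3
        exact (mem_filter.mp hp).2 (hp3 ▸ h3N)
      rw [this, sum_empty]; positivity
    · have hsub : S.filter (fun p ↦ p = 3) ⊆ {3} := by
        intro p hp; rw [mem_singleton]; exact (mem_filter.mp hp).2
      calc ∑ p ∈ S.filter (fun p ↦ p = 3), ((bad p).card : ℝ)
          ≤ ∑ p ∈ ({3} : Finset ℕ), ((bad p).card : ℝ) :=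
            sum_le_sum_of_subset_of_nonneg hsub (fun _ _ _ ↦ by positivity)
        _ = ((bad 3).card : ℝ) := by rw [sum_singleton]
        _ ≤ _ := by
            have hcop : N.Coprime 3 :=
              (Nat.Coprime.symm ((Nat.Prime.coprime_iff_not_dvd Nat.prime_three).mpr h3N))
            exact card_filter_class_nine_dvd_le hN hcop i₁ i₂ j₁ j₂ a₀ b₀
  -- p ≥ 5 part
  have h5part : ∑ p ∈ S.filter (fun p ↦ ¬ p = 3), ((bad p).card : ℝ) ≤
      (3 * I.card * J.card / (N : ℝ) ^ 2 + 2 * J.card) * (1 / 8) +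
        (I.card + J.card) * harmonicR P + (2 * I.card + 3) * Nat.primeCounting P := by
    have hsub : S.filter (fun p ↦ ¬ p = 3) ⊆ primesIcc 5 P := by
      intro p hp
      obtain ⟨hpS, hp3⟩ := mem_filter.mp hp
      obtain ⟨⟨h3, hP'⟩, hpr⟩ := mem_primesIcc.mp (mem_filter.mp hpS).1
      refine mem_primesIcc.mpr ⟨⟨?_, hP'⟩, hpr⟩
      by_contra h5
      interval_cases p
      · exact hp3 rfl
      · exact absurd hpr (by decide)
    have hterm : ∀ p ∈ S.filter (fun p ↦ ¬ p = 3), ((bad p).card : ℝ) ≤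
        (3 * I.card * J.card / (N : ℝ) ^ 2 + 2 * J.card) * (1 / (p : ℝ) ^ 2) +
          (I.card + J.card) * (1 / (p : ℝ)) + (2 * I.card + 3) := by
      intro p hp
      have hp5 := mem_primesIcc.mp (hsub hp)
      obtain ⟨hpS, _⟩ := mem_filter.mp hp
      have hpN : ¬ p ∣ N := (mem_filter.mp hpS).2
      have hcop : N.Coprime p :=
        Nat.Coprime.symm ((Nat.Prime.coprime_iff_not_dvd hp5.2).mpr hpN)
      have h1 := card_filter_class_sq_dvd_le hp5.2 hp5.1.1 hN hcop i₁ i₂ j₁ j₂ a₀ b₀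
      have h2 := local_bound_expand hI0 hJ0 hN1 (show (1 : ℝ) ≤ p by exact_mod_cast hp5.2.one_le)
      exact h1.trans h2
    calc ∑ p ∈ S.filter (fun p ↦ ¬ p = 3), ((bad p).card : ℝ)
        ≤ ∑ p ∈ S.filter (fun p ↦ ¬ p = 3),
            ((3 * I.card * J.card / (N : ℝ) ^ 2 + 2 * J.card) * (1 / (p : ℝ) ^ 2) +
              (I.card + J.card) * (1 / (p : ℝ)) + (2 * I.card + 3)) := sum_le_sum hterm
      _ ≤ ∑ p ∈ primesIcc 5 P,
            ((3 * I.card * J.card / (N : ℝ) ^ 2 + 2 * J.card) * (1 / (p : ℝ) ^ 2) +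
              (I.card + J.card) * (1 / (p : ℝ)) + (2 * I.card + 3)) :=
          sum_le_sum_of_subset_of_nonneg hsub (fun _ _ _ ↦ by positivity)
      _ = (3 * I.card * J.card / (N : ℝ) ^ 2 + 2 * J.card) *
              ∑ p ∈ primesIcc 5 P, (1 / (p : ℝ) ^ 2) +
            (I.card + J.card) * ∑ p ∈ primesIcc 5 P, (1 / (p : ℝ)) +
            (2 * I.card + 3) * (primesIcc 5 P).card := by
          rw [sum_add_distrib, sum_add_distrib, ← mul_sum, ← mul_sum, sum_const, nsmul_eq_mul]
          ring
      _ ≤ _ := by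
          have e1 := sum_primesIcc_five_inv_sq_le P
          have e2 := sum_primesIcc_inv_le (by norm_num : 1 ≤ 5) P
          have e3 : ((primesIcc 5 P).card : ℝ) ≤ Nat.primeCounting P := by
            exact_mod_cast card_primesIcc_le 5 P
          gcongr
  -- assemble
  have hexp1 : ((I.card : ℝ) / N - 1) * ((J.card : ℝ) / N - 1) =
      I.card * J.card / (N : ℝ) ^ 2 - I.card / N - J.card / N + 1 := by ring
  have hexp2 : ((I.card : ℝ) / (N * 3) + 1) * ((J.card : ℝ) / N + 1) =
      I.card * J.card / (N : ℝ) ^ 2 * (1 / 3) + I.card / (N * 3) + J.card / N + 1 := by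
    field_simp; ring
  have hb1 : (I.card : ℝ) / N ≤ I.card := div_le_self hI0 hN1
  have hb2 : (J.card : ℝ) / N ≤ J.card := div_le_self hJ0 hN1
  have hb3 : (I.card : ℝ) / (N * 3) ≤ I.card := div_le_self hI0 (by linarith)
  rw [hsplitS] at hcount
  rw [hexp1] at hclass
  rw [hexp2] at h3part
  set X := (I.card : ℝ) * J.card / (N : ℝ) ^ 2 with hX
  have e_a : (7 / 24 : ℝ) * I.card * J.card / (N : ℝ) ^ 2 = 7 / 24 * X := by rw [hX]; ring
  have e_c : (3 * (I.card : ℝ) * J.card / (N : ℝ) ^ 2 + 2 * J.card) * (1 / 8) =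
      3 / 8 * X + J.card / 4 := by rw [hX]; ring
  rw [e_a]; rw [e_c] at h5part
  linarith [harmonicR_nonneg P]

end Literature.NumberTheory.EllipticCurves.RankZeroSieve

namespace Literature.NumberTheory.EllipticCurves.RankZeroSieve

open Finset Filter Topology

/-! ### Scales `a(X) = X^{1/3}`, `b(X) = √X` and the boxes -/

/-- `a(X) = X^{1/3}`. [folklore] -/
noncomputable def aX (X : ℕ) : ℝ := (X : ℝ) ^ ((3 : ℝ)⁻¹)

/-- `b(X) = √X`. [folklore] -/
noncomputable def bX (X : ℕ) : ℝ := Real.sqrt X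

/-- `X^{1/3} ≥ 0`. [folklore] -/
theorem aX_nonneg (X : ℕ) : 0 ≤ aX X := Real.rpow_nonneg (Nat.cast_nonneg X) _

/-- `√X ≥ 0`. [folklore] -/
theorem bX_nonneg (X : ℕ) : 0 ≤ bX X := Real.sqrt_nonneg _

/-- `(X^{1/3})³ = X`. [folklore] -/
theorem aX_pow_three (X : ℕ) : aX X ^ 3 = X := by
  unfold aX
  rw [show ((3 : ℝ)⁻¹) = ((3 : ℕ) : ℝ)⁻¹ by norm_num]
  exact Real.rpow_inv_natCast_pow (Nat.cast_nonneg X) three_ne_zero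

/-- `(√X)² = X`. [folklore] -/
theorem bX_sq (X : ℕ) : bX X ^ 2 = X := Real.sq_sqrt (Nat.cast_nonneg X)

/-- `√X = X^{1/3}·√(X^{1/3})`. [folklore] -/
theorem bX_eq (X : ℕ) : bX X = aX X * Real.sqrt (aX X) := by
  unfold bX
  conv_lhs => rw [← aX_pow_three X]
  rw [pow_succ, Real.sqrt_mul (sq_nonneg _), Real.sqrt_sq (aX_nonneg X)]

/-- `X^{1/3} → ∞`. [folklore] -/
theorem tendsto_aX : Tendsto aX atTop atTop :=
  (tendsto_rpow_atTop (by norm_num : (0 : ℝ) < (3 : ℝ)⁻¹)).comp tendsto_natCast_atTop_atTop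

/-- `√(X^{1/3}) → ∞`. [folklore] -/
theorem tendsto_sqrt_aX : Tendsto (fun X ↦ Real.sqrt (aX X)) atTop atTop :=
  Real.tendsto_sqrt_atTop.comp tendsto_aX

/-- `√X → ∞`. [folklore] -/
theorem tendsto_bX : Tendsto bX atTop atTop := by
  refine (tendsto_aX.atTop_mul_atTop₀ tendsto_sqrt_aX).congr' ?_
  filter_upwards with X
  rw [bX_eq]

/-- `X^{1/3}/√X → 0`. [folklore] -/
theorem tendsto_aX_div_bX : Tendsto (fun X ↦ aX X / bX X) atTop (𝓝 0) := by
  have h : Tendsto (fun X ↦ (Real.sqrt (aX X))⁻¹) atTop (𝓝 0) :=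
    tendsto_inv_atTop_zero.comp tendsto_sqrt_aX
  refine h.congr' ?_
  filter_upwards [tendsto_aX.eventually_gt_atTop 0] with X hX
  have hs : 0 < Real.sqrt (aX X) := Real.sqrt_pos.mpr hX
  rw [bX_eq]
  field_simp

/-- `α = 33^{-1/3}`, the constant in `t(X) ≈ α X^{1/3}`. [folklore] -/
noncomputable def alpha : ℝ := ((33 : ℝ)⁻¹) ^ ((3 : ℝ)⁻¹)

/-- `α > 0`. [folklore] -/
theorem alpha_pos : 0 < alpha := Real.rpow_pos_of_pos (by norm_num) _

/-- `α³ = 1/33`. [folklore] -/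
theorem alpha_pow_three : alpha ^ 3 = (33 : ℝ)⁻¹ := by
  unfold alpha
  rw [show ((3 : ℝ)⁻¹) = ((3 : ℕ) : ℝ)⁻¹ by norm_num]
  exact Real.rpow_inv_natCast_pow (by norm_num) three_ne_zero

/-- `β = √(α³/7)`, the constant in `u(X) ≈ β X^{1/2}`. [folklore] -/
noncomputable def beta : ℝ := Real.sqrt (alpha ^ 3 / 7)

/-- `β > 0`. [folklore] -/
theorem beta_pos : 0 < beta := Real.sqrt_pos.mpr (by rw [alpha_pow_three]; norm_num)

/-- `t(X) = ⌊(X/33)^{1/3}⌋`. [folklore] -/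
noncomputable def tX (X : ℕ) : ℕ := ⌊((X : ℝ) / 33) ^ ((3 : ℝ)⁻¹)⌋₊

/-- `u(X) = ⌊√(t(X)³/7)⌋`. [folklore] -/
noncomputable def uX (X : ℕ) : ℕ := ⌊Real.sqrt ((tX X : ℝ) ^ 3 / 7)⌋₊

/-- `(X/33)^{1/3} = α X^{1/3}`. [folklore] -/
theorem root_div_eq (X : ℕ) : ((X : ℝ) / 33) ^ ((3 : ℝ)⁻¹) = alpha * aX X := by
  rw [div_eq_mul_inv, Real.mul_rpow (Nat.cast_nonneg X) (by norm_num)]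
  unfold aX alpha
  ring

/-- `t(X) ≤ α X^{1/3}`. [folklore] -/
theorem tX_le (X : ℕ) : (tX X : ℝ) ≤ alpha * aX X := by
  rw [← root_div_eq]; exact Nat.floor_le (Real.rpow_nonneg (by positivity) _)

/-- `α X^{1/3} < t(X) + 1`. [folklore] -/
theorem lt_tX_add_one (X : ℕ) : alpha * aX X < tX X + 1 := by
  rw [← root_div_eq]; exact Nat.lt_floor_add_one _

/-- `t(X)³ ≤ X/33`. [folklore] -/
theorem tX_pow_three_le (X : ℕ) : (tX X : ℝ) ^ 3 ≤ X / 33 := by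
  have h := Nat.floor_le (Real.rpow_nonneg (by positivity : (0 : ℝ) ≤ X / 33) (3 : ℝ)⁻¹)
  calc (tX X : ℝ) ^ 3 ≤ (((X : ℝ) / 33) ^ ((3 : ℝ)⁻¹)) ^ 3 :=
        pow_le_pow_left₀ (Nat.cast_nonneg _) h 3
    _ = X / 33 := by
        rw [show ((3 : ℝ)⁻¹) = ((3 : ℕ) : ℝ)⁻¹ by norm_num]
        exact Real.rpow_inv_natCast_pow (by positivity) three_ne_zero

/-- `u(X) ≤ √(t(X)³/7)`. [folklore] -/
theorem uX_le (X : ℕ) : (uX X : ℝ) ≤ Real.sqrt ((tX X : ℝ) ^ 3 / 7) :=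
  Nat.floor_le (Real.sqrt_nonneg _)

/-- `√(t(X)³/7) < u(X) + 1`. [folklore] -/
theorem lt_uX_add_one (X : ℕ) : Real.sqrt ((tX X : ℝ) ^ 3 / 7) < uX X + 1 :=
  Nat.lt_floor_add_one _

/-- `u(X)² ≤ t(X)³/7`. [folklore] -/
theorem uX_sq_le (X : ℕ) : (uX X : ℝ) ^ 2 ≤ (tX X : ℝ) ^ 3 / 7 := by
  calc (uX X : ℝ) ^ 2 ≤ (Real.sqrt ((tX X : ℝ) ^ 3 / 7)) ^ 2 :=
        pow_le_pow_left₀ (Nat.cast_nonneg _) (uX_le X) 2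
    _ = _ := Real.sq_sqrt (by positivity)

/-- `t(X)/X^{1/3} → α`. [folklore] -/
theorem tendsto_tX_div_aX : Tendsto (fun X ↦ (tX X : ℝ) / aX X) atTop (𝓝 alpha) := by
  have ha := tendsto_aX
  have hinv : Tendsto (fun X ↦ (aX X)⁻¹) atTop (𝓝 0) := tendsto_inv_atTop_zero.comp ha
  have hlow : Tendsto (fun X ↦ alpha - (aX X)⁻¹) atTop (𝓝 alpha) := by
    simpa using tendsto_const_nhds.sub hinv
  refine tendsto_of_tendsto_of_tendsto_of_le_of_le' hlow tendsto_const_nhds ?_ ?_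
  · filter_upwards [ha.eventually_gt_atTop 0] with X hX
    rw [le_div_iff₀ hX, sub_mul, inv_mul_cancel₀ hX.ne']
    linarith [lt_tX_add_one X]
  · filter_upwards [ha.eventually_gt_atTop 0] with X hX
    rw [div_le_iff₀ hX]; exact tX_le X

/-- `u(X)/√X → β`. [folklore] -/
theorem tendsto_uX_div_bX : Tendsto (fun X ↦ (uX X : ℝ) / bX X) atTop (𝓝 beta) := by
  have hg : Tendsto (fun X ↦ Real.sqrt (((tX X : ℝ) / aX X) ^ 3 / 7)) atTop (𝓝 beta) :=
    ((tendsto_tX_div_aX.pow 3).div_const 7).sqrt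
  have hgeq : ∀ᶠ X in atTop, Real.sqrt (((tX X : ℝ) / aX X) ^ 3 / 7) =
      Real.sqrt ((tX X : ℝ) ^ 3 / 7) / bX X := by
    filter_upwards [tendsto_aX.eventually_gt_atTop 0] with X hX
    rw [bX, ← Real.sqrt_div (by positivity)]
    congr 1
    rw [div_pow, ← aX_pow_three X]
    rw [aX_pow_three]
    field_simp
  have hg' : Tendsto (fun X ↦ Real.sqrt ((tX X : ℝ) ^ 3 / 7) / bX X) atTop (𝓝 beta) :=
    hg.congr' hgeq
  have hb := tendsto_bX
  have hinv : Tendsto (fun X ↦ (bX X)⁻¹) atTop (𝓝 0) := tendsto_inv_atTop_zero.comp hb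
  have hlow : Tendsto (fun X ↦ Real.sqrt ((tX X : ℝ) ^ 3 / 7) / bX X - (bX X)⁻¹) atTop
      (𝓝 beta) := by
    simpa using hg'.sub hinv
  refine tendsto_of_tendsto_of_tendsto_of_le_of_le' hlow hg' ?_ ?_
  · filter_upwards [hb.eventually_gt_atTop 0] with X hX
    rw [← one_div, ← sub_div, div_le_div_iff_of_pos_right hX]
    linarith [lt_uX_add_one X]
  · filter_upwards [hb.eventually_gt_atTop 0] with X hX
    exact div_le_div_of_nonneg_right (uX_le X) hX.le

/-- `t(X) → ∞`. [folklore] -/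
theorem tendsto_tX : Tendsto (fun X ↦ (tX X : ℝ)) atTop atTop := by
  have h := tendsto_tX_div_aX.pos_mul_atTop alpha_pos tendsto_aX
  refine h.congr' ?_
  filter_upwards [tendsto_aX.eventually_gt_atTop 0] with X hX
  field_simp

/-- `u(X) → ∞`. [folklore] -/
theorem tendsto_uX : Tendsto (fun X ↦ (uX X : ℝ)) atTop atTop := by
  have h := tendsto_uX_div_bX.pos_mul_atTop beta_pos tendsto_bX
  refine h.congr' ?_
  filter_upwards [tendsto_bX.eventually_gt_atTop 0] with X hX
  field_simp

/-- `P(X)`, a bound for `√|4A³ + 27B²|` on the box `|A| ≤ 2t(X)`, `|B| ≤ u(X)`. [folklore] -/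
noncomputable def PX (X : ℕ) : ℕ := Nat.sqrt (32 * tX X ^ 3 + 27 * uX X ^ 2) + 1

/-- On the box `|A| ≤ 2t(X)`, `|B| ≤ u(X)`: `|4A³ + 27B²| ≤ P(X)²`. [folklore] -/
theorem abs_negDisc_le_PX_sq (X : ℕ) {A B : ℤ} (hA : |A| ≤ 2 * tX X) (hB : |B| ≤ uX X) :
    |negDisc (A, B)| ≤ (PX X : ℤ) ^ 2 := by
  have h1 : |negDisc (A, B)| ≤ 4 * |A| ^ 3 + 27 * B ^ 2 := by
    rw [negDisc_apply]
    calc |4 * A ^ 3 + 27 * B ^ 2| ≤ |4 * A ^ 3| + |27 * B ^ 2| := abs_add_le _ _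
      _ = 4 * |A| ^ 3 + 27 * B ^ 2 := by
          rw [abs_mul, abs_mul, abs_pow, abs_of_nonneg (sq_nonneg B)]; norm_num
  have hA3 : |A| ^ 3 ≤ (2 * tX X : ℤ) ^ 3 := pow_le_pow_left₀ (abs_nonneg A) hA 3
  have hB2 : B ^ 2 ≤ (uX X : ℤ) ^ 2 := by
    rw [← sq_abs]; exact pow_le_pow_left₀ (abs_nonneg B) hB 2
  have h3 : ((32 * tX X ^ 3 + 27 * uX X ^ 2 : ℕ) : ℤ) < ((PX X : ℕ) : ℤ) ^ 2 := by
    unfold PX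
    exact_mod_cast Nat.lt_succ_sqrt' (32 * tX X ^ 3 + 27 * uX X ^ 2)
  push_cast at h3
  nlinarith

/-- `√X ≥ 1` for `X ≥ 1`. [folklore] -/
theorem one_le_bX {X : ℕ} (hX : 1 ≤ X) : 1 ≤ bX X := by
  unfold bX
  rw [show (1 : ℝ) = Real.sqrt 1 by simp]
  exact Real.sqrt_le_sqrt (by exact_mod_cast hX)

/-- `P(X) ≤ 9√X` for `X ≥ 1`. [folklore] -/
theorem PX_le {X : ℕ} (hX : 1 ≤ X) : (PX X : ℝ) ≤ 9 * bX X := by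
  have ht := tX_pow_three_le X
  have hu := uX_sq_le X
  have hn : ((32 * tX X ^ 3 + 27 * uX X ^ 2 : ℕ) : ℝ) ≤ 4 * X := by
    push_cast; nlinarith
  have hs : (Nat.sqrt (32 * tX X ^ 3 + 27 * uX X ^ 2) : ℝ) ≤ Real.sqrt (4 * X) := by
    calc (Nat.sqrt (32 * tX X ^ 3 + 27 * uX X ^ 2) : ℝ)
        = Real.sqrt (((Nat.sqrt (32 * tX X ^ 3 + 27 * uX X ^ 2)) : ℝ) ^ 2) :=
          (Real.sqrt_sq (Nat.cast_nonneg _)).symm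
      _ ≤ Real.sqrt ((32 * tX X ^ 3 + 27 * uX X ^ 2 : ℕ) : ℝ) :=
          Real.sqrt_le_sqrt (by exact_mod_cast Nat.sqrt_le' _)
      _ ≤ Real.sqrt (4 * X) := Real.sqrt_le_sqrt hn
  have h4 : Real.sqrt (4 * X) = 2 * bX X := by
    rw [Real.sqrt_mul (by norm_num), bX, show (4 : ℝ) = 2 ^ 2 by norm_num,
      Real.sqrt_sq (by norm_num)]
  have hb := one_le_bX hX
  unfold PX
  push_cast
  linarith

/-! ### Limits used for the error terms -/

/-- `log(a)/a → 0` along `a(X) → ∞`. [folklore] -/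
theorem tendsto_log_aX_div_aX : Tendsto (fun X ↦ Real.log (aX X) / aX X) atTop (𝓝 0) := by
  have h := Real.tendsto_pow_log_div_mul_add_atTop 1 0 1 one_ne_zero
  have h' : Tendsto (fun x : ℝ ↦ Real.log x / x) atTop (𝓝 0) := by
    simpa using h
  exact h'.comp tendsto_aX

/-- Chebyshev in the form used: `π(⌊y⌋)/y → 0`. [folklore] -/
theorem tendsto_primeCounting_floor_div :
    Tendsto (fun y : ℝ ↦ (Nat.primeCounting ⌊y⌋₊ : ℝ) / y) atTop (𝓝 0) := by
  -- upper bound (log 4 · y / log √y + √y) / y = log 4 / log √y + 1/√y → 0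
  have hlog : Tendsto (fun y : ℝ ↦ Real.log (Real.sqrt y)) atTop atTop :=
    Real.tendsto_log_atTop.comp Real.tendsto_sqrt_atTop
  have h1 : Tendsto (fun y : ℝ ↦ Real.log 4 / Real.log (Real.sqrt y)) atTop (𝓝 0) :=
    tendsto_const_nhds.div_atTop hlog
  have h2 : Tendsto (fun y : ℝ ↦ (Real.sqrt y)⁻¹) atTop (𝓝 0) :=
    tendsto_inv_atTop_zero.comp Real.tendsto_sqrt_atTop
  have hsum : Tendsto (fun y : ℝ ↦ Real.log 4 / Real.log (Real.sqrt y) + (Real.sqrt y)⁻¹) atTop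
      (𝓝 0) := by simpa using h1.add h2
  refine tendsto_of_tendsto_of_tendsto_of_le_of_le' tendsto_const_nhds hsum ?_ ?_
  · filter_upwards [eventually_gt_atTop 0] with y hy
    positivity
  · filter_upwards [eventually_gt_atTop 1] with y hy
    have hy0 : 0 < y := by linarith
    have hc := Chebyshev.pi_le_log4_mul_div hy
    have hs : 0 < Real.sqrt y := Real.sqrt_pos.mpr hy0
    calc (Nat.primeCounting ⌊y⌋₊ : ℝ) / y ≤ (Real.log 4 * y / Real.log (Real.sqrt y) + Real.sqrt y) / y :=
          div_le_div_of_nonneg_right hc hy0.le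
      _ = Real.log 4 / Real.log (Real.sqrt y) + (Real.sqrt y)⁻¹ := by
          have hL : Real.log (Real.sqrt y) ≠ 0 := by
            rw [Real.log_sqrt hy0.le]; exact (div_pos (Real.log_pos hy) two_pos).ne'
          have e1 : Real.log 4 * y / Real.log (Real.sqrt y) / y =
              Real.log 4 / Real.log (Real.sqrt y) := by
            field_simp
          have e2 : Real.sqrt y / y = (Real.sqrt y)⁻¹ := by
            rw [inv_eq_one_div, div_eq_div_iff hy0.ne' hs.ne', one_mul]
            exact Real.mul_self_sqrt hy0.le
          rw [add_div, e1, e2]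

end Literature.NumberTheory.EllipticCurves.RankZeroSieve

namespace Literature.NumberTheory.EllipticCurves.RankZeroSieve

open Finset Filter Topology
open scoped Classical

/-! ### The boxes and the main count -/

/-- The `A`-interval of the box: `[1, 2t(X)]` for sign `+` (`4A³ + 27B² > 0`) and
`[-2t(X), -t(X)-1]` for sign `-` (`4A³ + 27B² < 0`). [folklore] -/
noncomputable def Ibox (s : Bool) (X : ℕ) : Finset ℤ :=
  if s then Icc (1 : ℤ) (2 * (tX X : ℤ)) else Icc (-(2 * (tX X : ℤ))) (-(tX X : ℤ) - 1)

/-- The `B`-interval `[-u(X), u(X)]`. [folklore] -/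
noncomputable def Jbox (X : ℕ) : Finset ℤ := Icc (-(uX X : ℤ)) (uX X)

/-- `Ibox s X` is an interval. [folklore] -/
theorem exists_Ibox_eq (s : Bool) (X : ℕ) : ∃ i₁ i₂ : ℤ, Ibox s X = Icc i₁ i₂ := by
  unfold Ibox; split_ifs <;> exact ⟨_, _, rfl⟩

/-- `m_s = 2` or `1`: `#Ibox s X = m_s · t(X)`. [folklore] -/
noncomputable def mI (s : Bool) : ℝ := if s then 2 else 1

/-- `m_s ≥ 1`. [folklore] -/
theorem one_le_mI (s : Bool) : 1 ≤ mI s := by unfold mI; split_ifs <;> norm_num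

/-- `m_s > 0`. [folklore] -/
theorem mI_pos (s : Bool) : 0 < mI s := lt_of_lt_of_le one_pos (one_le_mI s)

/-- `#Ibox s X = m_s · t(X)`. [folklore] -/
theorem card_Ibox (s : Bool) (X : ℕ) : ((Ibox s X).card : ℝ) = mI s * tX X := by
  unfold Ibox mI
  cases s
  · simp only [Bool.false_eq_true, ↓reduceIte, Int.card_Icc]
    have : (-(tX X : ℤ) - 1 + 1 - -(2 * (tX X : ℤ))).toNat = tX X := by omega
    rw [this]; ring
  · simp only [↓reduceIte, Int.card_Icc]
    have : (2 * (tX X : ℤ) + 1 - 1).toNat = 2 * tX X := by omega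
    rw [this]; push_cast; ring

/-- `#Jbox X = 2u(X) + 1`. [folklore] -/
theorem card_Jbox (X : ℕ) : ((Jbox X).card : ℝ) = 2 * uX X + 1 := by
  unfold Jbox
  rw [Int.card_Icc]
  have : ((uX X : ℤ) + 1 - -(uX X : ℤ)).toNat = 2 * uX X + 1 := by omega
  rw [this]; push_cast; ring

/-- Pairs of the box have `|A| ≤ 2t(X)`, `|B| ≤ u(X)`. [folklore] -/
theorem abs_le_of_mem_box {s : Bool} {X : ℕ} {AB : ℤ × ℤ} (h : AB ∈ Ibox s X ×ˢ Jbox X) :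
    |AB.1| ≤ 2 * (tX X : ℤ) ∧ |AB.2| ≤ uX X := by
  rw [mem_product] at h
  obtain ⟨hA, hB⟩ := h
  unfold Jbox at hB
  rw [mem_Icc] at hB
  refine ⟨?_, abs_le.mpr hB⟩
  unfold Ibox at hA
  cases s
  · simp only [Bool.false_eq_true, ↓reduceIte, mem_Icc] at hA
    rw [abs_le]; omega
  · simp only [↓reduceIte, mem_Icc] at hA
    rw [abs_le]; omega

/-- On the `+` box (`A ≥ 1`), `4A³ + 27B² > 0`. [folklore] -/
theorem negDisc_pos_of_mem_box {X : ℕ} {AB : ℤ × ℤ} (h : AB ∈ Ibox true X ×ˢ Jbox X) :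
    0 < negDisc AB := by
  rw [mem_product] at h
  obtain ⟨hA, _⟩ := h
  simp only [Ibox, ↓reduceIte, mem_Icc] at hA
  have : negDisc AB = 4 * AB.1 ^ 3 + 27 * AB.2 ^ 2 := rfl
  rw [this]
  nlinarith [sq_nonneg AB.2, pow_pos (show (0:ℤ) < AB.1 by omega) 3]

/-- On the `-` box (`A ≤ -t(X)-1`, `27B² ≤ 27u(X)² ≤ 27t(X)³/7 < 4(t(X)+1)³`), `4A³ + 27B² < 0`.
[folklore] -/
theorem negDisc_neg_of_mem_box {X : ℕ} {AB : ℤ × ℤ} (h : AB ∈ Ibox false X ×ˢ Jbox X) :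
    negDisc AB < 0 := by
  have hB := (abs_le_of_mem_box h).2
  rw [mem_product] at h
  obtain ⟨hA, _⟩ := h
  simp only [Ibox, Bool.false_eq_true, ↓reduceIte, mem_Icc] at hA
  have hu7R : 7 * (uX X : ℝ) ^ 2 ≤ (tX X : ℝ) ^ 3 := by
    have := uX_sq_le X; linarith
  have hu7 : 7 * (uX X : ℤ) ^ 2 ≤ (tX X : ℤ) ^ 3 := by exact_mod_cast hu7R
  have hB2 : AB.2 ^ 2 ≤ (uX X : ℤ) ^ 2 := by
    rw [← sq_abs]; exact pow_le_pow_left₀ (abs_nonneg _) hB 2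
  have h3 : ((tX X : ℤ) + 1) ^ 3 ≤ (-AB.1) ^ 3 :=
    pow_le_pow_left₀ (by positivity) (by omega) 3
  have : negDisc AB = 4 * AB.1 ^ 3 + 27 * AB.2 ^ 2 := rfl
  rw [this]
  have ht0 : (0 : ℤ) ≤ tX X := by positivity
  nlinarith

/-- Pairs of the box have naive height `< X` (`4|A|³ ≤ 32t³ ≤ 32X/33`, `27B² ≤ 27u² ≤ 27X/231`), for
`X ≥ 1`. [folklore] -/
theorem height_lt_of_mem_box {s : Bool} {X : ℕ} (hX : 1 ≤ X) {AB : ℤ × ℤ}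
    (h : AB ∈ Ibox s X ×ˢ Jbox X) : 4 * |AB.1| ^ 3 < X ∧ 27 * AB.2 ^ 2 < X := by
  obtain ⟨hA, hB⟩ := abs_le_of_mem_box h
  have ht := tX_pow_three_le X
  have hu := uX_sq_le X
  have hX0 : (0 : ℝ) < X := by exact_mod_cast hX
  have hAR : ((|AB.1| : ℤ) : ℝ) ≤ 2 * (tX X : ℝ) := by exact_mod_cast hA
  have hBR : ((|AB.2| : ℤ) : ℝ) ≤ (uX X : ℝ) := by exact_mod_cast hB
  have hA3 : ((|AB.1| : ℤ) : ℝ) ^ 3 ≤ (2 * (tX X : ℝ)) ^ 3 :=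
    pow_le_pow_left₀ (by positivity) hAR 3
  have hB2 : ((|AB.2| : ℤ) : ℝ) ^ 2 ≤ (uX X : ℝ) ^ 2 := pow_le_pow_left₀ (by positivity) hBR 2
  have h8 : (2 * (tX X : ℝ)) ^ 3 = 8 * (tX X : ℝ) ^ 3 := by ring
  constructor
  · have : (4 : ℝ) * ((|AB.1| : ℤ) : ℝ) ^ 3 < X := by nlinarith
    exact_mod_cast this
  · have e : ((AB.2 : ℤ) : ℝ) ^ 2 = ((|AB.2| : ℤ) : ℝ) ^ 2 := by push_cast; rw [sq_abs]
    have : (27 : ℝ) * ((AB.2 : ℤ) : ℝ) ^ 2 < X := by rw [e]; nlinarith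
    exact_mod_cast this

/-! ### Limits of the pieces -/

/-- `#Ibox s X / X^{1/3} → m_s α`. [folklore] -/
theorem tendsto_card_Ibox_div (s : Bool) :
    Tendsto (fun X ↦ ((Ibox s X).card : ℝ) / aX X) atTop (𝓝 (mI s * alpha)) := by
  refine (tendsto_tX_div_aX.const_mul (mI s)).congr' (Eventually.of_forall fun X ↦ ?_)
  show mI s * ((tX X : ℝ) / aX X) = ((Ibox s X).card : ℝ) / aX X
  rw [card_Ibox, mul_div_assoc]

/-- `#Jbox X / √X → 2β`. [folklore] -/
theorem tendsto_card_Jbox_div :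
    Tendsto (fun X ↦ ((Jbox X).card : ℝ) / bX X) atTop (𝓝 (2 * beta)) := by
  have hb0 : Tendsto (fun X ↦ (bX X)⁻¹) atTop (𝓝 0) := tendsto_inv_atTop_zero.comp tendsto_bX
  have := (tendsto_uX_div_bX.const_mul 2).add hb0
  rw [add_zero] at this
  refine this.congr' ?_
  filter_upwards [tendsto_bX.eventually_gt_atTop 0] with X hX
  rw [card_Jbox, ← mul_div_assoc, inv_eq_one_div, ← add_div]

/-- `#Ibox s X · #Jbox X / (X^{1/3}√X) → m_s α · 2β`. [folklore] -/
theorem tendsto_card_mul_card_div (s : Bool) :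
    Tendsto (fun X ↦ ((Ibox s X).card : ℝ) * (Jbox X).card / (aX X * bX X)) atTop
      (𝓝 (mI s * alpha * (2 * beta))) := by
  refine ((tendsto_card_Ibox_div s).mul tendsto_card_Jbox_div).congr'
    (Eventually.of_forall fun X ↦ ?_)
  exact div_mul_div_comm _ _ _ _

/-- An algebraic identity (error term `E₁`). [folklore] -/
theorem alg_E1 {I J a b : ℝ} (ha : a ≠ 0) (hb : b ≠ 0) :
    2 * (I / a * b⁻¹) + (3 * (J / b * a⁻¹) + a⁻¹ * b⁻¹) = (2 * I + 3 * J + 1) / (a * b) := by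
  field_simp; ring

/-- The boundary error `(2#I + 3#J + 1)/(X^{1/3}√X) → 0`. [folklore] -/
theorem tendsto_E1 (s : Bool) :
    Tendsto (fun X ↦ (2 * ((Ibox s X).card : ℝ) + 3 * (Jbox X).card + 1) / (aX X * bX X))
      atTop (𝓝 0) := by
  have ha0 : Tendsto (fun X ↦ (aX X)⁻¹) atTop (𝓝 0) := tendsto_inv_atTop_zero.comp tendsto_aX
  have hb0 : Tendsto (fun X ↦ (bX X)⁻¹) atTop (𝓝 0) := tendsto_inv_atTop_zero.comp tendsto_bX
  have := (((tendsto_card_Ibox_div s).mul hb0).const_mul 2).add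
    (((tendsto_card_Jbox_div.mul ha0).const_mul 3).add (ha0.mul hb0))
  rw [mul_zero, mul_zero, mul_zero, mul_zero, mul_zero, add_zero, add_zero] at this
  refine this.congr' ?_
  filter_upwards [tendsto_aX.eventually_gt_atTop 0, tendsto_bX.eventually_gt_atTop 0] with X ha hb
  exact alg_E1 ha.ne' hb.ne'

/-- An algebraic identity. [folklore] -/
theorem alg_IJb {I J a b : ℝ} (ha : a ≠ 0) : I / a * (a / b) + J / b = (I + J) / b := by
  rw [add_div]; congr 1; field_simp

/-- `(#Ibox s X + #Jbox X)/√X → 2β`. [folklore] -/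
theorem tendsto_card_add_card_div (s : Bool) :
    Tendsto (fun X ↦ (((Ibox s X).card : ℝ) + (Jbox X).card) / bX X) atTop (𝓝 (2 * beta)) := by
  have := ((tendsto_card_Ibox_div s).mul tendsto_aX_div_bX).add tendsto_card_Jbox_div
  rw [mul_zero, zero_add] at this
  refine this.congr' ?_
  filter_upwards [tendsto_aX.eventually_gt_atTop 0] with X ha
  exact alg_IJb ha.ne'

/-- An algebraic identity (logarithmic error term). [folklore] -/
theorem alg_logb {c l a : ℝ} (ha : a ≠ 0) :
    c * a⁻¹ + 3 / 2 * (l / a) = (c + (l + l / 2)) / a := by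
  field_simp; ring

/-- `(c + log(9√X))/X^{1/3} → 0`. [folklore] -/
theorem tendsto_log_bX_div (c : ℝ) :
    Tendsto (fun X ↦ (c + Real.log (9 * bX X)) / aX X) atTop (𝓝 0) := by
  have ha0 : Tendsto (fun X ↦ (aX X)⁻¹) atTop (𝓝 0) := tendsto_inv_atTop_zero.comp tendsto_aX
  have := ((tendsto_const_nhds (x := c + Real.log 9)).mul ha0).add
    (tendsto_log_aX_div_aX.const_mul (3 / 2))
  rw [mul_zero, mul_zero, zero_add] at this
  refine this.congr' ?_
  filter_upwards [tendsto_aX.eventually_gt_atTop 0] with X ha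
  have hs : 0 < Real.sqrt (aX X) := Real.sqrt_pos.mpr ha
  rw [bX_eq, Real.log_mul (by norm_num) (by positivity), Real.log_mul ha.ne' hs.ne',
    Real.log_sqrt ha.le, alg_logb ha.ne']
  ring_nf

/-- The harmonic error `(#I + #J)·H_{P(X)}/(X^{1/3}√X) → 0` (`H_P ≤ 1 + log P`, `P(X) ≤ 9√X`). [folklore] -/
theorem tendsto_E2 (s : Bool) :
    Tendsto (fun X ↦ ((((Ibox s X).card : ℝ) + (Jbox X).card) * harmonicR (PX X)) /
      (aX X * bX X)) atTop (𝓝 0) := by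
  have hup := (tendsto_card_add_card_div s).mul (tendsto_log_bX_div 1)
  rw [mul_zero] at hup
  refine tendsto_of_tendsto_of_tendsto_of_le_of_le' tendsto_const_nhds hup ?_ ?_
  · filter_upwards [tendsto_aX.eventually_gt_atTop 0, tendsto_bX.eventually_gt_atTop 0]
      with X ha hb
    have := harmonicR_nonneg (PX X)
    positivity
  · filter_upwards [tendsto_aX.eventually_gt_atTop 0, tendsto_bX.eventually_gt_atTop 0,
      eventually_ge_atTop 1] with X ha hb hX1
    have hP0 : (0 : ℝ) < PX X := by
      have : 1 ≤ PX X := Nat.succ_le_succ (Nat.zero_le _)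
      exact_mod_cast this
    have hH : harmonicR (PX X) ≤ 1 + Real.log (9 * bX X) := by
      refine (harmonicR_le _).trans ?_
      have := Real.log_le_log hP0 (PX_le hX1)
      linarith
    have hnn : 0 ≤ (((Ibox s X).card : ℝ) + (Jbox X).card) / bX X := by positivity
    calc ((((Ibox s X).card : ℝ) + (Jbox X).card) * harmonicR (PX X)) / (aX X * bX X)
        = ((((Ibox s X).card : ℝ) + (Jbox X).card) / bX X) * (harmonicR (PX X) / aX X) := by
          rw [div_mul_div_comm, mul_comm (bX X)]
      _ ≤ ((((Ibox s X).card : ℝ) + (Jbox X).card) / bX X) *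
            ((1 + Real.log (9 * bX X)) / aX X) := by
          gcongr

/-- `(2#Ibox s X + 3)/X^{1/3} → 2 m_s α`. [folklore] -/
theorem tendsto_card_Ibox_div' (s : Bool) :
    Tendsto (fun X ↦ (2 * ((Ibox s X).card : ℝ) + 3) / aX X) atTop
      (𝓝 (2 * (mI s * alpha))) := by
  have ha0 : Tendsto (fun X ↦ (aX X)⁻¹) atTop (𝓝 0) := tendsto_inv_atTop_zero.comp tendsto_aX
  have := ((tendsto_card_Ibox_div s).const_mul 2).add (ha0.const_mul 3)
  rw [mul_zero, add_zero] at this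
  refine this.congr' ?_
  filter_upwards [tendsto_aX.eventually_gt_atTop 0] with X ha
  rw [add_div, mul_div_assoc, div_eq_mul_inv (3 : ℝ)]

/-- The prime-count error `(2#I + 3)·π(P(X))/(X^{1/3}√X) → 0` (Chebyshev: `π(y)/y → 0`, `P(X) ≤ 9√X`).
[folklore] -/
theorem tendsto_E3 (s : Bool) :
    Tendsto (fun X ↦ ((2 * ((Ibox s X).card : ℝ) + 3) * Nat.primeCounting (PX X)) /
      (aX X * bX X)) atTop (𝓝 0) := by
  have hpi : Tendsto (fun X ↦ (Nat.primeCounting ⌊9 * bX X⌋₊ : ℝ) / (9 * bX X)) atTop (𝓝 0) :=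
    tendsto_primeCounting_floor_div.comp (tendsto_bX.const_mul_atTop (by norm_num : (0:ℝ) < 9))
  have hup := (tendsto_card_Ibox_div' s).mul (hpi.const_mul 9)
  rw [mul_zero, mul_zero] at hup
  refine tendsto_of_tendsto_of_tendsto_of_le_of_le' tendsto_const_nhds hup ?_ ?_
  · filter_upwards [tendsto_aX.eventually_gt_atTop 0, tendsto_bX.eventually_gt_atTop 0]
      with X ha hb
    positivity
  · filter_upwards [tendsto_aX.eventually_gt_atTop 0, tendsto_bX.eventually_gt_atTop 0,
      eventually_ge_atTop 1] with X ha hb hX1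
    have hmono : (Nat.primeCounting (PX X) : ℝ) ≤ Nat.primeCounting ⌊9 * bX X⌋₊ := by
      exact_mod_cast Nat.monotone_primeCounting (Nat.le_floor (PX_le hX1))
    have hnn : 0 ≤ (2 * ((Ibox s X).card : ℝ) + 3) / aX X := by positivity
    have e : 9 * ((Nat.primeCounting ⌊9 * bX X⌋₊ : ℝ) / (9 * bX X)) =
        (Nat.primeCounting ⌊9 * bX X⌋₊ : ℝ) / bX X := by
      rw [← mul_div_assoc, mul_div_mul_left _ _ (by norm_num : (9:ℝ) ≠ 0)]
    calc ((2 * ((Ibox s X).card : ℝ) + 3) * Nat.primeCounting (PX X)) / (aX X * bX X)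
        = ((2 * ((Ibox s X).card : ℝ) + 3) / aX X) * (Nat.primeCounting (PX X) / bX X) :=
          (div_mul_div_comm _ _ _ _).symm
      _ ≤ ((2 * ((Ibox s X).card : ℝ) + 3) / aX X) *
            (9 * ((Nat.primeCounting ⌊9 * bX X⌋₊ : ℝ) / (9 * bX X))) := by
          rw [e]
          gcongr

/-- **The main count.** For a class `(a₀, b₀)` modulo `N ≥ 1`, compatible at the odd primes
dividing `N`, and either sign: for some `c > 0`, eventually in `X` at least `c·X^{1/3}·X^{1/2}`
pairs `(A, B)` of the box `Ibox s X × Jbox X` lie in the class and have `4A³ + 27B²` squarefree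
away from `2`. [folklore] -/
theorem main_count (s : Bool) {N : ℕ} (hN : 0 < N) (a₀ b₀ : ℤ)
    (hcompat : ∀ p : ℕ, p.Prime → p ≠ 2 → (p : ℤ) ∣ N →
      (p : ℤ) ^ 2 ∣ N ∧ ¬ (p : ℤ) ^ 2 ∣ negDisc (a₀, b₀)) :
    ∃ c : ℝ, 0 < c ∧ ∀ᶠ X : ℕ in atTop, c * (aX X * bX X) ≤
      ((((Ibox s X ×ˢ Jbox X).filter (fun AB : ℤ × ℤ ↦
        (AB.1 ≡ a₀ [ZMOD N] ∧ AB.2 ≡ b₀ [ZMOD N]) ∧ OddSqfree AB)).card : ℕ) : ℝ) := by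
  set L : ℝ := mI s * alpha * (2 * beta) with hL
  have hL0 : 0 < L := by
    have := alpha_pos; have := beta_pos; have := mI_pos s; positivity
  have hN0 : (0 : ℝ) < N := by exact_mod_cast hN
  refine ⟨7 / 96 * L / (N : ℝ) ^ 2, by positivity, ?_⟩
  set δ₀ : ℝ := 7 * L / (288 * (N : ℝ) ^ 2) with hδ₀
  have hδ₀pos : 0 < δ₀ := by positivity
  have hev1 : ∀ᶠ X in atTop, 3 / 4 * L ≤ ((Ibox s X).card : ℝ) * (Jbox X).card / (aX X * bX X) :=
    (tendsto_card_mul_card_div s).eventually_const_le (by linarith)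
  have hevE1 := (tendsto_E1 s).eventually_le_const hδ₀pos
  have hevE2 := (tendsto_E2 s).eventually_le_const hδ₀pos
  have hevE3 := (tendsto_E3 s).eventually_le_const hδ₀pos
  have hevt : ∀ᶠ X in atTop, (N : ℝ) + 1 ≤ tX X := tendsto_tX.eventually_ge_atTop _
  have hevu : ∀ᶠ X in atTop, (N : ℝ) ≤ uX X := tendsto_uX.eventually_ge_atTop _
  filter_upwards [hev1, hevE1, hevE2, hevE3, hevt, hevu, tendsto_aX.eventually_gt_atTop 0,
    tendsto_bX.eventually_gt_atTop 0, eventually_ge_atTop 1]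
    with X hQ hE1' hE2' hE3' ht hu ha hb hX1
  have hab : 0 < aX X * bX X := mul_pos ha hb
  -- hypotheses of the sieve inequality
  have hIN : (N : ℝ) ≤ (Ibox s X).card := by
    rw [card_Ibox]; nlinarith [one_le_mI s]
  have hJN : (N : ℝ) ≤ (Jbox X).card := by rw [card_Jbox]; linarith
  have ht1 : 1 ≤ tX X := by
    have : (1 : ℝ) ≤ tX X := by linarith [hN0.le]
    exact_mod_cast this
  have hP3 : 3 ≤ PX X := by
    unfold PX
    have : 2 ≤ Nat.sqrt (32 * tX X ^ 3 + 27 * uX X ^ 2) := by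
      rw [Nat.le_sqrt]
      nlinarith [Nat.one_le_pow 3 (tX X) ht1]
    omega
  have hPbox : ∀ AB ∈ Ibox s X ×ˢ Jbox X, |negDisc AB| ≤ (PX X : ℤ) ^ 2 := by
    intro AB hAB
    obtain ⟨hA, hB⟩ := abs_le_of_mem_box hAB
    exact abs_negDisc_le_PX_sq X (A := AB.1) (B := AB.2) (by exact_mod_cast hA) hB
  obtain ⟨i₁, i₂, hIeq⟩ := exists_Ibox_eq s X
  rw [hIeq] at hIN hPbox hQ hE1' hE2' hE3' ⊢
  have hsieve := sieve_lower_bound i₁ i₂ (-(uX X : ℤ)) (uX X) hN a₀ b₀ hcompat hP3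
    hPbox hIN hJN
  -- from ratios to products
  set Q : ℝ := ((Icc i₁ i₂).card : ℝ) * (Jbox X).card with hQdef
  have hQ' : 3 / 4 * L * (aX X * bX X) ≤ Q := (le_div_iff₀ hab).mp hQ
  have hE1'' := (div_le_iff₀ hab).mp hE1'
  have hE2'' := (div_le_iff₀ hab).mp hE2'
  have hE3'' := (div_le_iff₀ hab).mp hE3'
  set W : ℝ := L * (aX X * bX X) / (N : ℝ) ^ 2 with hW
  have hW0 : 0 ≤ W := by positivity
  have e0 : (7 / 24 : ℝ) * (Icc i₁ i₂).card * (Jbox X).card / (N : ℝ) ^ 2 =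
      7 / 24 / (N : ℝ) ^ 2 * Q := by rw [hQdef]; ring
  have hmain : 7 / 32 * W ≤ 7 / 24 / (N : ℝ) ^ 2 * Q := by
    have := mul_le_mul_of_nonneg_left hQ' (by positivity : (0 : ℝ) ≤ 7 / 24 / (N : ℝ) ^ 2)
    calc 7 / 32 * W = 7 / 24 / (N : ℝ) ^ 2 * (3 / 4 * L * (aX X * bX X)) := by rw [hW]; ring
      _ ≤ _ := this
  have eδ : δ₀ * (aX X * bX X) = 7 / 288 * W := by rw [hδ₀, hW]; ring
  have ec : 7 / 96 * L / (N : ℝ) ^ 2 * (aX X * bX X) = 7 / 96 * W := by rw [hW]; ring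
  rw [eδ] at hE1'' hE2'' hE3''
  rw [ec]
  have hsieve' : (7 / 24 : ℝ) * (Icc i₁ i₂).card * (Jbox X).card / (N : ℝ) ^ 2
      - (2 * (Icc i₁ i₂).card + 3 * (Jbox X).card + 1)
      - ((Icc i₁ i₂).card + (Jbox X).card) * harmonicR (PX X)
      - (2 * (Icc i₁ i₂).card + 3) * Nat.primeCounting (PX X) ≤
      ((((Icc i₁ i₂ ×ˢ Jbox X).filter (fun AB : ℤ × ℤ ↦
        (AB.1 ≡ a₀ [ZMOD N] ∧ AB.2 ≡ b₀ [ZMOD N]) ∧ OddSqfree AB)).card : ℕ) : ℝ) := hsieve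
  rw [e0] at hsieve'
  linarith

end Literature.NumberTheory.EllipticCurves.RankZeroSieve

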